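import Summits.SmoothPoincare4.SmoothPoincare4.Theses.EntropyRung
import Summits.SmoothPoincare4.SmoothPoincare4.Theses.WeylBudget
import Literature.Geometry.Riemannian.HamiltonCurvatureODE
import Literature.Geometry.Riemannian.ChangGurskyYangEuler
import Literature.Geometry.Riemannian.ChernGaussBonnetFour
import Literature.Geometry.Riemannian.ChernGaussBonnetFourProofs
import Literature.Geometry.Riemannian.HamiltonPCOClassificationKillingHopf
import HarnessLib
import HarnessLib.Audit
import Summits.SmoothPoincare4.SmoothPoincare4.Theorems.EntropyRungMargerinRailsDefs
import Summits.SmoothPoincare4.SmoothPoincare4.Theorems.EntropyRungChangGurskyYangStubInitialFit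
import Summits.SmoothPoincare4.SmoothPoincare4.Theorems.EntropyRungChangGurskyYangStubMargerinPolynomial
import Summits.SmoothPoincare4.SmoothPoincare4.Theorems.EntropyRungChangGurskyYangStubPinchingPreserved
import Summits.SmoothPoincare4.SmoothPoincare4.Theorems.EntropyRungChangGurskyYangStubMaximalFlow
import Summits.SmoothPoincare4.SmoothPoincare4.Theorems.EntropyRungChangGurskyYangStubInvariantPinching
import Summits.SmoothPoincare4.SmoothPoincare4.Theorems.EntropyRungChangGurskyYangStubThm14Psc
import Summits.SmoothPoincare4.SmoothPoincare4.Theorems.EntropyRungChangGurskyYangOfGvPathFacts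
import Literature.Geometry.Riemannian.GurskyViaclovskyC1Estimate
import Literature.Geometry.Riemannian.GurskyViaclovskyC2Estimate
import Literature.Geometry.Riemannian.GurskyViaclovskyC2EstimateProofs
import Literature.Geometry.Riemannian.GurskyViaclovskyC1EstimateProofs
import Literature.Geometry.Riemannian.GurskyViaclovskyOpenness
import Literature.Geometry.Riemannian.GurskyViaclovskyLinearisation
import Literature.Analysis.FunctionSpaces.HolderManifoldModelIsomorphism
import Summits.SmoothPoincare4.SmoothPoincare4.Theorems.EntropyRungChangGurskyYangStubModelEstimate
import Summits.SmoothPoincare4.SmoothPoincare4.Theorems.EntropyRungChangGurskyYangStubBackgroundScalarTendsto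
import Summits.SmoothPoincare4.SmoothPoincare4.Theorems.EntropyRungChangGurskyYangStubPathMapStrictFDeriv
import Literature.Geometry.Riemannian.GurskyViaclovskyClosedness
import Literature.Geometry.Riemannian.GurskyViaclovskyClosednessEvansKrylov
import Literature.Geometry.Riemannian.ChangGurskyYangTheorem14
import Literature.Geometry.Riemannian.RicciFlowMaximal
import Literature.Geometry.Riemannian.RicciFlowScaling
import Literature.Geometry.Riemannian.MetricTraceScaling
import Literature.Geometry.Riemannian.CurvatureNormSq
import Literature.Geometry.Riemannian.CurvatureDerivativeNormSq
import Literature.Geometry.Riemannian.HamiltonCurvatureRatio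
import Literature.Geometry.Riemannian.RicciFlowScalarMaximumPrinciple
import Summits.SmoothPoincare4.SmoothPoincare4.Theorems.EntropyRungChangGurskyYangStubCurvatureRatio
import Summits.SmoothPoincare4.SmoothPoincare4.Theorems.EntropyRungChangGurskyYangStubRoundnessRate
import Summits.SmoothPoincare4.SmoothPoincare4.Theorems.EntropyRungChangGurskyYangStubScaledShi
import Summits.SmoothPoincare4.SmoothPoincare4.Theorems.EntropyRungChangGurskyYangStubGradientEstimates
import Summits.SmoothPoincare4.SmoothPoincare4.Theorems.EntropyRungChangGurskyYangStubSmoothRoundLimit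

/-!
# Line `margerin-cone-hamilton-rails` for crux `EntropyRung.ChangGurskyYang` (stmt-SmoothPoincare4-10834)

LEAD STATUS r19 (continuation lead c8, 2026-08-17): O1 `stub_pathMapStrictFDeriv` LANDED (p166234,
Theorems/EntropyRungChangGurskyYangStubPathMapStrictFDeriv.lean; + Literature GurskyViaclovskyChartEquationC2 p165362,
GurskyViaclovskyBackgroundNaturalityC2 p164198, EllipticityNearGraph p165926, CoordinateJetsDirectional p165301, helper
`helper_differentiateEquation` p166045) and is now a one-line call. TWO sorries remain: O2 `stub_linearisedInvertible`,
O3 `stub_regularity` (wave 2 running on the registered helper stubs). Statements unchanged.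

LEAD STATUS r18 (continuation lead c8, 2026-08-17 ~17:10Z): TWO of the five r17 stubs LANDED in wave 1 and are now one-line calls —
O5 `stub_modelEstimate` (p164915, Theorems/EntropyRungChangGurskyYangStubModelEstimate.lean, + Literature HolderManifoldModelEllipticity p164692)
and O4 `stub_backgroundScalarTendsto` (p165061, Theorems/EntropyRungChangGurskyYangStubBackgroundScalarTendsto.lean); helper stubs
`helper_segmentSupBound` (p164052), `helper_holderTwoOfLimit` (p164280, + Literature HolderBallLimit p163999) and the lead's Literature files
`Analysis/FunctionSpaces/HolderManifoldNemytskii.lean` (p164197) / `Geometry/Riemannian/GurskyViaclovskyChartStructure.lean` (p164651) landed too.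
THREE sorries remain = O1 `stub_pathMapStrictFDeriv` (PROVED by the lead modulo the pending `helper_chartEquationC2`; lands next),
O2 `stub_linearisedInvertible` (wave 2: `helper_linearisedChartRep` + `stub_linearisedInvertible_of_chartRep`), O3 `stub_regularity` (wave 2:
`helper_dqRegularityStep`, `helper_differentiateEquation`, `helper_regularityInduction(_of)`, `stub_regularity_of_induction`). Statements unchanged.

LEAD RESHAPE r17 (continuation lead c8, prover-line-stmt-SmoothPoincare4-10834-c8-0, 2026-08-17 ~14:45Z): THE LAST ONE-FACT STUB
`stub_gvOpen` (≡ `gurskyViaclovsky_pathOpen_weighted_four`, GV 2003 Prop. 2 + §5 openness) IS OPENED. It is now sorry-free GLUE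
(implicit function theorem in `X = C^{2,α}_𝔄(M)`, `Y = C^{0,α}_𝔄(M)` = the tree's `HolderManifoldFunction 𝔄 ℝ k α`, `α = 1/2`, over
`GurskyViaclovskyOpennessProofs.lean`) calling FIVE NEW REGISTERED STUBS (section `OpennessStubs`): O1 `stub_pathMapStrictFDeriv`
(the zero-finding map `Φ(t,w) = F_t(w) − q e^{−4w}` is strictly differentiable `ℝ × X → Y` with `∂_wΦ = 𝓛_{t,w} + 4q e^{−4w}`
pointwise; chart Nemytskii operators), O2 `stub_linearisedInvertible` (GV Prop. 2: that linearisation is invertible — global Schauder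
estimate `exists_schauder_global` + maximum principle + method of continuity from `Δ_g − 1`), O3 `stub_regularity` (`C^{2,α}_𝔄` admissible
solutions are `C^∞`: GT Lemma 17.16, regularity half — difference quotients), O4 `stub_backgroundScalarTendsto` (admissibility persists),
O5 `stub_modelEstimate` (`hest` of `exists_modelOperator_continuousLinearEquiv_of_estimate`, consumed by O2). FIVE sorries = these five
stubs; every other statement of r16 is byte-identical (`stub_gvClosed` = `gurskyViaclovsky_pathClosed_weighted_four_holds`, c7).

LEAD STATUS r16 (continuation lead c7, 2026-08-17 ~06:56Z): `stub_gvClosed` DISCHARGED (`gurskyViaclovsky_pathClosed_weighted_four_holds`,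
GT 17.14 Evans–Krylov + 17.16 bootstrap + extraction, p144632); ONE sorry = `stub_gvOpen`.

LEAD STATUS r15 (continuation lead c6, prover-line-stmt-SmoothPoincare4-10834-c6-0, 2026-08-17 ~01:30Z): THE FLOW LEAF IS CLOSED.
STUB 4.B5 `stub_smoothRoundLimit` (Hamilton 1982 §14 Lemma 14.2 + §17: the scaled metrics `g/(T−t)` of the Type-I roundening
flow converge smoothly, on the FIXED compact manifold, to a `C^∞` metric of constant sectional curvature `1/6`) is DISCHARGED —
`Theorems/EntropyRungChangGurskyYangStubSmoothRoundLimit.lean`, assembled from eight landed layers: the round-defect evolution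
inequality `∂ₜ|Rm − g⊙g/(6(T−t))|² ≤ Δ − 2|∇Rm|² + C(|Rm|²+(T−t)⁻²)·|defect| + C|Rm|·|defect|²` (p130034, with Literature
`CoordRoundDefectTensor/Evolution` p129622/p129803), the Bernstein–Shi window lemma (p128927), decay of `|∇Rm|²` and of all
`|∇ᵏRm|²` (p129772, p129815), chart data and graded Grönwall with integrable rates for `g/(T−t)` (p129384, p130093, Literature
`EvolutionDerivBoundsIntegrable` p129124, `RicciFlowScaledChartBounds/Cauchy` p129830/p129974), the smooth limit metric (p129422)
and its roundness `Ric = g'/2`, `W = 0` (p130673). Hence `stub_pinchedFlowConvergence` (STUB 4 = Hamilton 1986 §5.2) is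
sorry-free and fact-free, `hamilton_convergenceCriterion_four_holds` is a theorem (Theorems/EntropyRungChangGurskyYangFlowLeafClosed.lean),
and the crux holds modulo the TWO Gursky–Viaclovsky one-fact leaves `stub_gvOpen`, `stub_gvClosed` (`ChangGurskyYang_of_twoFacts`);
both are under live upstream Schauder / Evans–Krylov discharge. TWO sorries remain. Every statement of r12–r14 is byte-identical.

LEAD RESHAPE r14 (continuation lead c6, prover-line-stmt-SmoothPoincare4-10834-c6-0, 2026-08-16 ~22:40Z): STUB 4.B1
`stub_gradientEstimates` (Hamilton 1982 Thm. 11.1 + Lemma 17.4, the PDE heart of the flow leaf) is DISCHARGED — assembled in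
`Theorems/EntropyRungChangGurskyYangStubGradientEstimates.lean` from five landed pieces: H0 `helper_hamiltonEvolution` (lead,
p127742: the evolution inequality of `u = |∇R|²/R + N|E|² − ηR²` transported to the manifold from the landed coordinate computation
`CoordHamiltonGradientFunction.lean` p127042), H1/H2 `helper_hamiltonSmoothGradSq/RicciNormSq` (p127527: joint smoothness of
`|∇R|²`, `|Ric|²` on space-time), H3 `helper_gradientBound_of_evolution` (p127842: Thm. 11.1 by the weak maximum principle),
H4 `helper_gradientDecay_of_evolution` (p127847: Lemma 17.4, comparison `A(T−t)^{τ−2} + B(T−t)^{c₁}`, `δ = τ`). THREE sorries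
remain = three registered stubs: `stub_smoothRoundLimit` (Hamilton 1982 §14/§17 smooth convergence of `g/(T−t)`; layer 1
`helper_logGronwall` landed p126948), `stub_gvOpen`, `stub_gvClosed` (one-fact σ₂ stubs; upstream: Schauder `hest` of
`exists_modelOperator_continuousLinearEquiv_of_estimate` resp. Evans–Krylov `hbounds` of `pathClosed_of_chartHigherBounds`,
both under live literature-prover seats). Every statement of r12/r13 is byte-identical.

LEAD STATUS r13 (continuation lead c6, prover-line-stmt-SmoothPoincare4-10834-c6-0, 2026-08-16 ~21:45Z): three of the five
Hamilton-1982 stubs of r12 LANDED in c5's wave and are now called by name — `stub_curvatureRatio` (p126761, Aux p126633),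
`stub_roundnessRate` (p127038, Aux p126845 + p126919), `stub_scaledShi` (p126273). FOUR sorries remain = four registered stubs:
`stub_gradientEstimates` [LEAD: manifold transport of the landed chart inequality `CoordHamiltonGradientFunction.lean` (p127042,
c5) + two weak-maximum-principle endgames, its pieces registered as `helper_` stubs], `stub_smoothRoundLimit` [worker;
`helper_logGronwall` landed p126948], `stub_gvOpen`, `stub_gvClosed` [one-fact σ₂ stubs under live upstream Schauder discharge].
Every statement of r12 is byte-identical.

LEAD RESHAPE r12 (continuation lead c5, prover-line-stmt-SmoothPoincare4-10834-c5-0, 2026-08-16 ~21:00Z): THE FLOW LEAF IS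
RE-OPENED ALONG HAMILTON'S OWN 1982 ROUTE. `stub_hamiltonCompactness` (≡ `hamilton_compactness_ricciFlow_slice_four`, the
Cheeger–Gromov–Hamilton compactness theorem — unworked by anybody, XL, and per c3 not profitably splittable) LEAVES the skeleton,
together with the blow-up chain 4c.1–4f that consumed it (all LANDED: p110613, p110705, p110789, p110802, p112089, p112107,
p112264, p115618, p124403 — the compactness closure `ChangGurskyYang_of_threeFacts` stays in the tree as the alternative).
STUB 4 `stub_pinchedFlowConvergence` (= `hamilton_convergenceCriterion_four`, Hamilton 1986 §5.2) is instead sorry-free glue over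
FIVE NEW REGISTERED STUBS implementing Hamilton 1986 p. 164 "the rest of the proof goes through unchanged" = Hamilton 1982
§§11–17 / Huisken 1985 §§4–6 on the FIXED compact manifold (see the section "STUB 4 RE-OPENED ALONG HAMILTON'S OWN ROUTE"):
`stub_gradientEstimates` (1982 Thm. 11.1 + Lemma 17.4: `F = |∇R|²/R + N|E|²`; the PDE heart, LEAD), `stub_curvatureRatio`
(Thm. 15.1 — geometric half already the tree's `one_sub_mul_le_of_ricci_ge_of_mfderiv_le`), `stub_roundnessRate` (§16/17.2:
Type-I sandwich `1 ≤ (T−t)R ≤ 3`, `|(T−t)R − 2| ≤ C(T−t)^δ`), `stub_scaledShi` (Shi for ONE Type-I flow: per-flow inequality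
constants are uniform in time), `stub_smoothRoundLimit` (Lemma 14.2 + §17: `g(t)/(T−t) → g'` smooth with `Ric = g'/2`, `W = 0`).
SEVEN sorries = seven registered stubs: these five + `stub_gvOpen`, `stub_gvClosed` (under live upstream discharge, not duplicated).
Discharging the five proves `hamilton_convergenceCriterion_four`, which is also (H1) of the tree's Hamilton-1986 PCO classification.

LEAD RESHAPE r11 (continuation lead c4, prover-line-stmt-SmoothPoincare4-10834-c4-0, 2026-08-16): STUB 6a `stub_gvGradient` is
DISCHARGED — this lead PROVED the Gursky–Viaclovsky `C¹` estimate, `gurskyViaclovsky_gradientEstimate_weighted_four_holds`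
(`Literature/Geometry/Riemannian/GurskyViaclovskyC1EstimateProofs.lean`: GV 2003 Prop. 5 — the maximum principle for `|∇u|²_g` in
charts, `Lorentzian/CoordSigma2GradientEstimate.lean` (first/second-order conditions at the maximum, `Hess |∇f|²` in an orthonormal
EIGENFRAME of `Hess f`, the once-differentiated equation, the Ricci identity), GV Lemma 2 as the pure cone algebra
`Lorentzian/CoordSigma2GradientAlgebra.lean`, and Glaeser's inequality `Analysis/Calculus/GlaeserInequality.lean` for the weight
`|W_g|²`, which is what lets every bad term carry the factor `tr W ≳ √Φ` so that only the UPPER bound on `u` is used; axioms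
`propext`/`Classical.choice`/`Quot.sound`). THREE sorries remain = three one-fact stubs: `stub_hamiltonCompactness`
(Hamilton 1995 compactness, slice form), `stub_gvOpen`, `stub_gvClosed` (GV openness / closedness — Schauder, IFT, Evans–Krylov,
under live upstream discharge). Every other statement and proof of r10 is byte-identical.

LEAD RESHAPE r10 (continuation lead c3, 2026-08-16 ~18:55Z): STUB 6b `stub_gvHessian` is DISCHARGED — the tree now PROVES
the Gursky–Viaclovsky `C²` estimate, `gurskyViaclovsky_hessianEstimate_weighted_four_holds`
(`Literature/Geometry/Riemannian/GurskyViaclovskyC2EstimateProofs.lean`, 18:29Z: Chen's maximum principle for `Δu + |∇u|²` in charts,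
`Lorentzian/CoordSigma2LaplacianEstimate.lean`, `CoordSigma2PathLocalEstimate.lean`; axioms `propext`/`Classical.choice`/`Quot.sound`);
the stub is now the one-line call (a separate `Theorems/…StubGvHessian.lean` is refused by the gate as `dedup.landed`, so the discharge
lives here). FOUR sorries remained at r10 = four one-fact stubs: `stub_hamiltonCompactness`, `stub_gvGradient`, `stub_gvOpen`, `stub_gvClosed`.

LEAD RESHAPE r9 (continuation lead c3, prover-line-stmt-SmoothPoincare4-10834-c3-0, 2026-08-16 ~17:00Z): STUB 6
`stub_thm14Psc` (≡ the named fact `changGurskyYang_theorem14_four`, CGY 2003 Thm. 1.4) is no longer a `sorry`: it is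
sorry-free GLUE over four registered one-fact stubs — the Gursky–Viaclovsky weighted-path facts
`stub_gvGradient : gurskyViaclovsky_gradientEstimate_weighted_four` (GV 2003 Prop. 5 / Chen 2005 Thm. 1(a)),
`stub_gvHessian : gurskyViaclovsky_hessianEstimate_weighted_four` (GV Prop. 6 / Chen 2005),
`stub_gvOpen : gurskyViaclovsky_pathOpen_weighted_four` (GV Prop. 2 + implicit function theorem),
`stub_gvClosed : gurskyViaclovsky_pathClosed_weighted_four` (GV §5: Evans–Krylov + Schauder + Arzelà–Ascoli) —
through the LANDED theorems `changGurskyYang_theorem14_four_of_gvPathFacts` (line `gv-continuity-path`, lead c1, p108727: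
GV×4 ⇒ Thm 1.4, with `stub_pathHarnack` p97575, the `C⁰` estimate, `κ`-invariance and smoothness PROVED) and
`stub_thm14Psc_of_theorem14` (p83080). The two worked lines have thereby MERGED: FIVE sorries remain and each is
`exact X_holds` away from ONE named Literature fact of the debt queue — `hamilton_compactness_ricciFlow_slice_four`
(STUB 4c.4, flow leaf) and the four GV facts (STUB 6a–6d, σ₂ leaf; being discharged upstream:
`GurskyViaclovsky{C2EstimateProofs,OpennessProofs,Linearisation,Ellipticity,ClosednessProofs,ClosednessLimit,
ClosednessChartBounds}.lean`). Every other statement and proof of r8 is byte-identical.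

LEAD RESHAPE r8 (lead c2, 2026-08-16 ~16:05Z): Level-2 — STUB 4c `stub_blowupLimit` (the named fact
`ricciFlow_blowupLimit_four`, filed by this lead and LANDED as `Literature/…/RicciFlowBlowupLimit.lean`,
p110613) is itself PROVED (sorry-free glue) from the stubs `stub_pointPicking` (p112264), `stub_rescaledFlow`
(p112089), `stub_rescaledNoncollapsed` (p112107) — all LANDED (wave 2) — and the ONE purer named fact
`hamilton_compactness_ricciFlow_slice_four` (Hamilton 1995 Thm. 1.2 / Morgan–Tian Thm. 5.15; filed by this
lead, LANDED `Literature/…/HamiltonCompactnessRicciFlow.lean`, p111788; `stub_hamiltonCompactness`). TWO sorries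
remain = the two XL named facts `hamilton_compactness_ricciFlow_slice_four` (STUB 4c.4) and
`changGurskyYang_theorem14_four` (STUB 6, upstream via GV×4). r5–r7: the five stubs of r5 all LANDED
(p110641, p110603, p110802, p110705, p110789); conditional closings in
`Theorems/EntropyRungChangGurskyYangOfBlowupLimit.lean` (p113080: STUB 4 ⇐ blow-up limit;
`hamilton_convergenceCriterion_four` ⇐ blow-up limit; crux ⇐ blow-up limit ∧ Thm 1.4).

LEAD RESHAPE r5 (prover-line-stmt-SmoothPoincare4-10834-c2-0, continuation lead c2, 2026-08-16 15:30Z): STUB 4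
`stub_pinchedFlowConvergence` (≡ the bespoke fact `hamilton_convergenceCriterion_four`, the one debt shared
with line `gv-continuity-path` and the only one without a discharge effort) is OPENED along the blow-up /
round-limit endgame (see the section "STUB 4 OPENED" below): it is now PROVED, sorry-free, from the new
registered stubs `stub_maximalFlow` (S), `stub_invariantPinching` (S), `stub_blowupLimit` (= the ONE new
named fact `ricciFlow_blowupLimit_four`: Hamilton 1995 compactness + Perelman NLC packaged as Topping 2006
Thm. 8.5.1, stated inline for relocation), `stub_limitRound` (M), `stub_roundRecognition` (M),
`stub_transfer` (M), over the tree's PROVED Ricci-flow library (maximal existence, finite singular time,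
curvature blow-up, no local collapsing, Shi, Schur, Besse 1.118, Myers, Hopf–Rinow–Heine–Borel). Seven
sorries = six new stubs + STUB 6; the statements of STUBS 1–3, 5, 6 and of STUB 4 itself are unchanged.

LEAD RESHAPE r4 (prover-line-stmt-SmoothPoincare4-10834-1, re-seated lead, 2026-08-16 10:20Z): STUB 5
`stub_chernGaussBonnetFour` is DISCHARGED by the tree's theorem `chernGaussBonnet_four_holds`
(`Literature/Geometry/Riemannian/ChernGaussBonnetFourProofs.lean`, Chern's intrinsic vector-field proof,
kernel-checked, axioms `propext`/`Classical.choice`/`Quot.sound`); TWO sorries remain = the two classical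
named debts `hamilton_convergenceCriterion_four` (STUB 4) and `changGurskyYang_theorem14_four` (STUB 6),
each with its conditional helper landed (p84954, p83080). Stub statements unchanged.

LEAD RESHAPE r2 (prover-line-stmt-SmoothPoincare4-10834-0, 2026-08-16: vocabulary moved to
`Theorems/EntropyRungMargerinRailsDefs.lean`, stub statements unchanged; STUBS 1–3 discharged by the landed
Theorems files `…StubMargerinPolynomial` (lead), `…StubInitialFit`, `…StubPinchingPreserved` (workers);
STUBS 4–6 remain = the three classical named debts `hamilton_convergenceCriterion_four`,
`chernGaussBonnet_four`, `changGurskyYang_theorem14_four` (conditional helpers landed for 4 and 6)) of the PLANNER'S SKELETON v1 (crux-plan, planner-cruxplan-stmt-SmoothPoincare4-10834-margerin-cone-hamilt-0,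
2026-08-16). Card `Cruxes/ChangGurskyYang/Ideas/margerin-cone-hamilton-rails.md` (ideator 1; triage
r1-1, r1-2, r1-3: pass ×3, merge target of `margerin-block-polynomial` and `margerin-certified-cone`).

THE CRUX is VERBATIM the named fact `changGurskyYang_sphere_four` (Chang–Gursky–Yang 2003, Thm. A,
simply connected `scal > 0` case): a closed simply connected 4-manifold carrying a `C^∞` Riemannian
metric with `R > 0` and `∫|W|² dV < 32π²` is diffeomorphic to `S⁴`. The tree proves CGY's §2 as the
reduction to three leaves `hCGB` (Chern–Gauss–Bonnet), `hThm14` (CGY Thm. 1.4, α = 1) and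
`hMargerin` (Margerin 1998, Thm. 1: closed connected `M⁴`, `R > 0`, weak pinching
`WP = (|W|² + 2|E|²)/R² < 1/6` pointwise ⇒ `M ≅ S⁴` or `ℝP⁴`).

THE LINE opens the leaf `hMargerin` on the rails the tree laid for Hamilton 1986/1997: in Hamilton's
block coordinates `(A, B, C)` of the curvature operator (`blockA/B/C`, `HamiltonODE.Blocks`,
`HamiltonODE.field` = the reaction ODE `M' = M² + M^#`) Margerin's cone `WP ≤ c` is
`margerinCone c = {|𝒟|² ≤ c R²}` with `R = tr A + tr C`, `|𝒟|² = ‖A‖² + 2‖B‖² + ‖C‖² − R²/6`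
(the round cone of half-angle 45° about the identity ray when `c = 1/6`), and his fundamental
polynomial is `margerinP2 = R·(|𝒟|²)' − 2|𝒟|²·R' = R³·(WP)'` along the ODE. The leaf becomes:

* STUB 1 `stub_margerinPolynomial` (ALGEBRA = Margerin 1998 Prop. 4 with Lemma 5 / Prop. 28, in the
  MARGIN form the three triagers asked for): for `0 ≤ c < 1/6` there is `σ ∈ (0, 1]` with
  `P₂ ≤ −σ·|𝒟|²·R'` on `margerinCone c` (⟺ `P_β ≤ 0` for `β = 2 − σ`: `β`-weak pinching improves);
* STUB 2 `stub_initialFit` (DICTIONARY + COMPACTNESS): on a closed 4-manifold, `R > 0` and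
  `WP < 1/6` pointwise put the blocks of every orthonormal frame into one pinching set
  `pinchingSet m c K τ = margerinCone c ∩ {R ≥ m} ∩ {|𝒟|² ≤ K R^{2−τ}}` (`m, c, K > 0`, `c < 1/6`);
* STUB 3 `stub_pinchingPreserved` (PDE TRANSFER): given STUB 1's inequality with margin `σ`, every
  `pinchingSet m c K τ` with `0 < τ < σ` is preserved along every Ricci flow of Riemannian metrics on
  a closed 4-manifold (Hamilton's tensor maximum principle `hamilton_maximumPrinciple_curvatureODE`
  applied to a closed convex `B`-even ODE-invariant set — OR Margerin's own scalar route: the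
  PROVED `weakMaximumPrinciple` on `u_β = |𝒟|² R^{−β}`, Margerin Cor. 3);
* STUB 4 `stub_pinchedFlowConvergence` (ENDGAME = Hamilton 1986 criterion 5.2 / Margerin Part VI /
  the noncollapsed round-limit of card `noncollapsed-round-limit`): a closed connected 4-manifold
  whose every Ricci flow from `g₀` stays in one such pinching set carries a metric of constant
  sectional curvature `k > 0`;
* then Killing–Hopf (`killingHopf_quotient_four`, PROVED) and "the only quotient of `S⁴` is `ℝP⁴`"
  (`nonempty_diffeomorph_or_isRealProjectiveSpace_of_orthogonal_quotient`, PROVED) give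
  `S⁴ ∨ ℝP⁴` — `margerin_of_stubs` below, kernel-checked;
* STUB 5 `stub_chernGaussBonnetFour : chernGaussBonnet_four` (named fact, classical XL debt, shared
  with line `cgy-variance-pivot` of crux CompactShrinkerGap) and STUB 6 `stub_thm14Psc` (CGY Thm. 1.4
  in the CONNECTED `scal > 0` shape = Disproof §7 `Thm14LeafPsc` = cards gv-continuity-path /
  gv-weyl-shifted-path verbatim; NOT the paper-false unconnected `hThm14`) are the two untouched
  leaves; `ChangGurskyYang_of : ChangGurskyYang` composes everything into the crux BY NAME, calling the six
  stubs (CGY §2 p. 121 line by line, `χ(M) ≥ 2` and `π₁(ℝP⁴) ≠ 1` being theorems of the tree);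
  `ChangGurskyYang_of_hypotheses` is the same glue with the stub statements as hypotheses, kernel-checked
  with NO `sorry` (axioms propext / Classical.choice / Quot.sound); `ChangGurskyYang_of_weylBudget` restates
  it for the item's second route decl (`WeylBudget.ChangGurskyYang`, the same proposition).

DISPROOF USED (`Cruxes/ChangGurskyYang/Disproof.lean`, cdisprove gen 2 v4, read 2026-08-16): §0
`crux_iff_fact`; §3a `changGurskyYang_false_without_compact` (LANDED
`Theorems/ChangGurskyYang/Negative/WithoutCompactFalse`) — honoured: `[CompactSpace M]` is a binder of
STUBS 2, 3, 4, 5, 6 and is USED in STUB 2 (minimum of `R`, maximum of `WP`), STUB 3 (maximum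
principle on a closed manifold), STUB 4 (`T < ∞`, Myers/compactness of the limit) and STUB 5; §3b
`changGurskyYang_false_without_simplyConnected` (LANDED `…/Negative/WithoutSimplyConnectedFalse`) —
honoured: without `π₁ = 1` the line outputs exactly `S⁴ ∨ ℝP⁴` (`margerin_of_stubs`), and `π₁ = 1`
is spent once, in `ChangGurskyYang_of`, to discard `ℝP⁴` (and inside `χ ≥ 2`); §7 `thm14Leaf_false`
(PAPER) — honoured: STUB 6 is `Thm14LeafPsc`, with `[ConnectedSpace M]`; §7 `MargerinLeafNonStrict`
PAPER-false (`ℂP²`, `S³×S¹` at `WP ≡ 1/6`) — honoured: STUB 1 is stated on the sub-cones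
`c < 1/6` only and STUB 2 produces `c < 1/6` from the STRICT pointwise hypothesis; §4 thresholds
untouched (no constant is changed). Triage r1-2/r1-3 kernel refutations (`TriageR1K3Witness.lean`,
`TriageR1K2Sketch3Antisym.lean`: the polynomial inequality is FALSE off the Bianchi locus, witness
`(I + K, 0, I)`, `F = +144`) — honoured: `margerinCone` carries `A, C` symmetric and `tr A = tr C`.
Negatives index (`ledger negatives --problem SmoothPoincare4`): nothing on this crux's vocabulary.
-/

noncomputable section

open Set Function Module Filter
open scoped Manifold ContDiff Matrix BigOperators Topology ENNReal

namespace Summit.SmoothPoincare4.SmoothPoincare4.Cruxes.ChangGurskyYang.MargerinConeHamiltonRails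

set_option linter.unusedVariables false
set_option linter.dupNamespace false

open Summit.SmoothPoincare4.SmoothPoincare4.Theses.EntropyRung (ChangGurskyYang)
open Literature.Geometry.Riemannian Literature.Geometry.Riemannian.HamiltonODE
open Literature.Geometry.Lorentzian Literature.Geometry.Lorentzian.PseudoRiemannianMetric
open Literature.Topology.FourManifolds
open Summit.SmoothPoincare4.SmoothPoincare4.Theorems.MargerinRails
  (frobSq pairing scal rmNormSq devNormSq margerinCone margerinP2 pinchingSet)

/-- Local notation: the standard `S⁴ ⊂ ℝ⁵`. -/
local notation "𝕊⁴" => (Metric.sphere (0 : EuclideanSpace ℝ (Fin 5)) 1)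

/-! ## Vocabulary

The line's objects `frobSq`, `pairing`, `scal`, `rmNormSq`, `devNormSq`, `margerinCone`, `margerinP2`,
`pinchingSet` (previously defined in this workfile) now live VERBATIM in the Theorems-side definitions
file `Summits/SmoothPoincare4/SmoothPoincare4/Theorems/EntropyRungMargerinRailsDefs.lean`
(namespace `Summit.SmoothPoincare4.SmoothPoincare4.Theorems.MargerinRails`, opened above; lead reshape
r1, 2026-08-16), so that stub proofs land as `Theorems/…` files importing it; the registered stub
signatures below are textually unchanged. Calibration lemmas (`devNormSq_idRay`, `devNormSq_cylinder`,
`idRay_mem_pinchingSet`) moved with them. -/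

/-! ## The registered stubs -/

/-- **STUB 1 — MARGERIN'S POLYNOMIAL INEQUALITY IN MARGIN FORM (the algebraic heart; Margerin 1998,
Prop. 4 with Lemma 5, "largely an algebraic problem … the heart of the paper", Parts II–V).** For
every `0 ≤ c < 1/6` there is `σ ∈ (0, 1]` such that on the closed cone `margerinCone c` (Bianchi
locus, `R ≥ 0`, `|𝒟|² ≤ c R²`) the fundamental polynomial satisfies
`margerinP2 p ≤ −σ · |𝒟|²(p) · R'(p)`, i.e. `P_{2−σ}(p) ≤ 0`: along Hamilton's ODE, `|𝒟|²/R^{2−σ}` is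
non-increasing wherever the solution sits in the cone (and a fortiori `WP = |𝒟|²/R²` is). Both sides
are homogeneous of degree 4, so this is a statement on the compact slice `{R = 1} ∩ margerinCone c`;
near the axis `P₂ = −2‖b‖² − 3(‖α‖² + ‖γ‖²) + O(|𝒟|³) ≤ −|𝒟|²·(1 + o(1))` (triage r1-1), away from it
`P₂ < 0` strictly for `WP ≤ c < 1/6` (Margerin Prop. 4; numerically: max `P₂` on `{WP = w}` is
`−1.4e−3, −1.7e−3, −8.5e−4, −6.6e−5` at `w = .02, .05, .10, .15`, four independent codes, kit j008113 /
j008125 / j010008 / j010014), so `σ(c) > 0` exists by compactness; `σ(c) → 0` as `c → 1/6` (tangency on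
the `ℂP²`, `ℂP̄²`, `S³×ℝ` rays at `c = 1/6`, Prop. 28 — the sharp closed-cone statement `P₂ ≤ 0` on
`margerinCone (1/6)` is the `σ = 0` limit and is deliberately NOT registered: nothing in the line
needs it and its zero set is positive-dimensional). Discharge: by hand along Margerin Parts III–V
(reduction to `A`, `C` diagonal by `SO(3) × SO(3)`, 9 + 4 variables), or by an SOS / nlsat
certificate of the STRICT margin form on `{R = 1, δ ≤ WP ≤ c}` plus the near-axis quadratic form
(cards margerin-block-polynomial / margerin-certified-cone). FALSE if the symmetry / trace binders of
`margerinCone` are dropped (kernel witness `(I + K, 0, I)`, `TriageR1K3Witness.lean`).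
[cite: Margerin1998, Part I, Prop. 4 and Lemma 5 (pp. 27–29); Prop. 28 (p. 58)]
[cite: Huisken1985, §2–3 (the same quantity with the non-sharp constant)] -/
theorem stub_margerinPolynomial :
    ∀ c : ℝ, 0 ≤ c → c < 1 / 6 → ∃ σ : ℝ, 0 < σ ∧ σ ≤ 1 ∧
      ∀ p ∈ margerinCone c, margerinP2 p ≤ -(σ * (devNormSq p * scal (field p))) :=
  -- LANDED (lead, p82963): Theorems/EntropyRungChangGurskyYangStubMargerinPolynomial.lean
  Summit.SmoothPoincare4.SmoothPoincare4.Theorems.MargerinRails.stub_margerinPolynomial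

/-- **STUB 2 — INITIAL FIT (dictionary `WP`/blocks + compactness; cf. `PinchingEstimatesInitialFit.lean`
and `HamiltonPCOPinchingSet.exists_bound_blocks` for the PCO programme).** On a closed smooth
4-manifold with a `C^∞` Riemannian metric `g` of positive scalar curvature and weak pinching
`WP < 1/6` pointwise there are `m > 0`, `0 < c < 1/6` such that for every `τ ∈ [0, 1]` some `K > 0`
puts the Hamilton blocks `(A, B, C)` of EVERY Levi-Civita connection of `g`, at every point in every
`g`-orthonormal frame, into `pinchingSet m c K τ`. Content: (i) the blocks of a Levi-Civita connection
are symmetric with `tr A = tr C` (`blockA_isSymm`, `blockC_isSymm`, `trace_blockA_eq_trace_blockC`,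
PROVED), `tr A + tr C = R(x)` and `|𝒟|²(blocks) = Σ W² + 2 Σ E² = WP(x)·R(x)²` in an orthonormal
frame (`weylNormSqFrame_eq_hamiltonBlocks` PROVED for `|W|² = ‖Å‖² + ‖C̊‖²`; `2|E|² = 2‖B‖²` and the
trace identity are the same bookkeeping; `weakPinching_eq_of_isOrthonormalFrame`; all Levi-Civita
connections have the same curvature, `IsLeviCivita.eq_leviCivita_holds`); (ii) `R ≥ m := min R > 0`,
`WP ≤ max WP < 1/6` (continuity of `R`, `|W|²`, `|E|²` on the compact `M`; take
`c := max (max WP) (1/12)`), `|𝒟|² ≤ c·R² ≤ c·R_max²`, and `K := c·R_max²/m^{2−τ} + 1`. Checks: round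
`S⁴` (`𝒟 = 0`, any `c`), and the statement is vacuous-true on the empty manifold.
[cite: Margerin1998, Part I, p. 25] [cite: ChangGurskyYang2003, (0.2)] [cite: Hamilton1986, §7, Thm. 7.1 (p. 170: "every compact subset … lies in some such pinching set")] -/
theorem stub_initialFit :
    ∀ (M : Type) [TopologicalSpace M] [T2Space M] [SecondCountableTopology M]
      [ChartedSpace (EuclideanSpace ℝ (Fin 4)) M] [IsManifold (𝓡 4) ∞ M] [CompactSpace M]
      (g : PseudoRiemannianMetric (𝓡 4) ∞ (EuclideanSpace ℝ (Fin 4)) (TangentSpace (𝓡 4) : M → Type _))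
      [g.HasLeviCivita], g.IsRiemannian → (∀ x, 0 < g.scalarCurvature x) →
      (∀ x, g.weakPinching x < 1 / 6) →
      ∃ m c : ℝ, 0 < m ∧ 0 < c ∧ c < 1 / 6 ∧ ∀ τ : ℝ, 0 ≤ τ → τ ≤ 1 → ∃ K : ℝ, 0 < K ∧
        ∀ (cov : CovariantDerivative (𝓡 4) (EuclideanSpace ℝ (Fin 4)) (TangentSpace (𝓡 4) : M → Type _)),
          g.IsLeviCivita cov →
          ∀ (x : M) (e : Fin 4 → TangentSpace (𝓡 4) x), g.IsOrthonormalFrame x e →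
            (g.blockA cov x e, g.blockB cov x e, g.blockC cov x e) ∈ pinchingSet m c K τ :=
  -- LANDED (worker W1, p82915): Theorems/EntropyRungChangGurskyYangStubInitialFit.lean
  Summit.SmoothPoincare4.SmoothPoincare4.Theorems.MargerinRails.stub_initialFit

/-- **STUB 3 — THE PINCHING SETS ARE PRESERVED ALONG THE RICCI FLOW (PDE transfer; Margerin 1998
Cor. 3 + Prop. 4 ⇒ "the maximum of the weak pinching is non-increasing" and `β`-weak pinching is
preserved, p. 27/p. 56; Hamilton 1986 §4–§5).** Let `0 < m`, `0 < c < 1/6`, `0 < K`, `0 < τ < σ ≤ 1`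
and suppose STUB 1's inequality holds with margin `σ` on `margerinCone c`. Then along every Ricci
flow `(g, cov)` of Riemannian metrics on `[0, T)` on a closed smooth 4-manifold whose initial blocks
lie in `Z = pinchingSet m c K τ` (every point, every `g 0`-orthonormal frame), the blocks of
`(g t, cov t)` lie in `Z` for all `t ∈ [0, T)`. TWO PROOFS ON OFFER. (T) Tensor route: `Z` is closed
(`R ↦ R^{2−τ}` continuous, `2 − τ > 0`), convex (second-order cone `√|𝒟|² ≤ √c·R`; hypograph of the
concave `R ↦ √K R^{1−τ/2}`; half-space `R ≥ m`; linear Bianchi locus), `B ↦ −B` symmetric (`|𝒟|²` is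
even in `B`), and FORWARD INVARIANT under `HamiltonODE.field`: the Bianchi locus is invariant
(`isInvariant_isSymm`, `isInvariant_trace_eq`, PROVED), `R' = (tr A)² + (tr C)² + 2‖B‖² ≥ R²/2 > 0`
(`trace_field_fst`), and by STUB 1 with `τ < σ` every curved boundary piece is crossed STRICTLY
inwards (`(WP)' = P₂/R³ ≤ −σ·c·R'/R < 0` on `{WP = c}`; `(|𝒟|²R^{τ−2})' = P_{2−τ}/R^{3−τ} ≤ −(σ−τ)K·R'/R < 0`
on `{|𝒟|² = K R^{2−τ}}`, which misses the axis since `K m^{2−τ} > 0`) — a first-exit-time argument, no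
Nagumo needed; then the named fact `hamilton_maximumPrinciple_curvatureODE` (Hamilton 1986 Thm. 4.3 /
Chow–Lu Thm. 3, stated for the printed `+2B^#` field with `B`-even `Z`, exactly as in
`ricciFlow_mem_pcoPinchingFive_of_maximumPrinciple`). (S) Margerin's SCALAR route (the card's point:
consumes only PROVED PDE): `u = |𝒟|²·R^{−β}` satisfies `∂ₜu ≤ Δu + 2(β−1)R⁻¹⟨∇R, ∇u⟩ + R^{−β−1}·P_β(Rm)`
(Margerin (4), Cor. 3, dropping two non-positive gradient terms; from `∂ₜRm = ΔRm + Rm² + Rm^#` in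
coordinates: `CoordCurvatureNormEvolution`, `apply_varRiemAt_of_flow`,
`ricciFlow_hasDerivWithinAt_scalarCurvatureWith`, PROVED) and the PROVED `weakMaximumPrinciple`
(`RicciFlowScalarMaximumPrinciple.lean`, transport term allowed) bounds `max u`, first with `β = 2` on
`{WP ≤ c}` (continuity in `t` keeps `WP` inside `[c, 1/6)` long enough to apply STUB 1), then with
`β = 2 − τ`. Honours Disproof §3a (`[CompactSpace M]` used by either maximum principle).
[cite: Margerin1998, Part I, Cor. 3 and Prop. 4 (pp. 26–27), p. 56] [cite: Hamilton1986, §4, Thm. 4.3 (p. 162); §5, 5.2 (p. 164)] [cite: ChowLu2004, Thm. 3] -/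
theorem stub_pinchingPreserved :
    ∀ (m c K σ τ : ℝ), 0 < m → 0 < c → c < 1 / 6 → 0 < K → 0 < τ → τ < σ → σ ≤ 1 →
      (∀ p ∈ margerinCone c, margerinP2 p ≤ -(σ * (devNormSq p * scal (field p)))) →
      ∀ (M : Type) [TopologicalSpace M] [T2Space M] [SecondCountableTopology M] [CompactSpace M]
        [ChartedSpace (EuclideanSpace ℝ (Fin 4)) M] [IsManifold (𝓡 4) ∞ M] (T : ℝ)
        (g : ℝ → PseudoRiemannianMetric (𝓡 4) ∞ (EuclideanSpace ℝ (Fin 4))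
          (TangentSpace (𝓡 4) : M → Type _))
        (cov : ℝ → CovariantDerivative (𝓡 4) (EuclideanSpace ℝ (Fin 4))
          (TangentSpace (𝓡 4) : M → Type _)),
        IsRicciFlow g cov (Ico 0 T) → (∀ t ∈ Ico 0 T, (g t).IsRiemannian) →
        (∀ (x : M) (e : Fin 4 → TangentSpace (𝓡 4) x), (g 0).IsOrthonormalFrame x e →
          ((g 0).blockA (cov 0) x e, (g 0).blockB (cov 0) x e, (g 0).blockC (cov 0) x e) ∈
            pinchingSet m c K τ) →
        ∀ t ∈ Ico 0 T, ∀ (x : M) (e : Fin 4 → TangentSpace (𝓡 4) x),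
          (g t).IsOrthonormalFrame x e →
            ((g t).blockA (cov t) x e, (g t).blockB (cov t) x e, (g t).blockC (cov t) x e) ∈
              pinchingSet m c K τ :=
  -- LANDED (worker W2): Theorems/EntropyRungChangGurskyYangStubPinchingPreserved.lean
  Summit.SmoothPoincare4.SmoothPoincare4.Theorems.MargerinRails.stub_pinchingPreserved

/-! ## STUB 4 OPENED (lead reshape r5, continuation lead c2): the blow-up / round-limit endgame

STUB 4 `stub_pinchedFlowConvergence` (= the bespoke named fact `hamilton_convergenceCriterion_four`,
Hamilton 1986 §5.2, the one debt shared by this line and `gv-continuity-path`) is no longer a `sorry`: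
it is PROVED below (`stub_pinchedFlowConvergence`, sorry-free glue) from five registered stubs and ONE
standard named fact, along the second endgame its own docstring offers (Margerin 1998 p. 57 "any
differential sphere theorem once `WP → 0`"; card `noncollapsed-round-limit`; Hamilton 1995 §16 /
Perelman 2002 §4 / Topping 2006 §8.5): take the maximal Ricci flow from `g₀` (it is finite-time since
`R ≥ m > 0`, `stub_maximalFlow`); blow up at the singular time — the named fact
`ricciFlow_blowupLimit_four` (Hamilton's compactness theorem + Perelman's no local collapsing +
Cheeger–Gromov–Taylor, packaged as in Topping 2006 Thm. 8.5.1 / Morgan–Tian 2007 Def. 5.3, Cor. 5.10,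
Thm. 5.15) hands over a complete connected pointed limit `(N, h, pinf)` of the rescaled slices
`Qₙ g(tₙ)`, `Qₙ² = max_{M×[0,tₙ]} |Rm|² → ∞`, together with the exhaustion / comparison maps and the
convergence of the rescaled curvature invariants `R`, `|Rm|²`, `|W|²`, `|E|²` along them; the
scale-breaking pinching `|W|² + 2|E|² ≤ K R^{2−τ}` (the invariant form of `pinchingSet`,
`stub_invariantPinching`) becomes `|W|² + 2|E|² ≤ K Qₙ^{−τ} (R/Qₙ)^{2−τ} → 0` after rescaling, so the
limit is Einstein and conformally flat with `R_h(pinf) = √6 > 0` (`stub_limitRound`); Schur + Besse 1.118 +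
Myers + Hopf–Rinow–Heine–Borel make it a COMPACT space of constant curvature `k > 0`
(`stub_roundRecognition`); a compact limit is reached by ONE comparison map, which is then a bijective
local diffeomorphism `N → M`, i.e. a diffeomorphism, and the constant-curvature metric is transported to
`M` (`stub_transfer`). Every analytic input except the compactness theorem is a THEOREM of the tree
(`ricciFlow_maximal_existence_holds`, `ricciFlow_singularTime_le_holds`,
`ricciFlow_curvature_blowup_of_shortTime ricciFlow_shortTime_existence_holds`,
`perelman_noLocalCollapsing_holds`, global Shi `IsRicciFlow.curvDerivNormSq_le_of_curvatureBoundedBy`,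
`exists_ricci_eq_const_smul_of_ricci_eq_smul`, `hasConstantSectionalCurvature_of_ricci_eq_of_weylFrame_eq_zero`,
`edist_le_pi_div_sqrt_of_ricci_ge`, `isCompact_setOf_edist_le`, `riemann_comap_apply`,
Mathlib `IsLocalDiffeomorph.diffeomorphOfBijective`). -/

/-- **STUB 4a — THE MAXIMAL FLOW FROM `g₀` IS FINITE-TIME** (Hamilton 1982, Thm. 14.1 = tree theorem
`ricciFlow_maximal_existence_holds`: immortal flow or maximal flow on `[0, T)`; the immortal alternative is
excluded because the pinching hypothesis, applied to that flow at `t = 0`, gives `R = tr A + tr C ≥ m > 0`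
(`scal_blocks_eq`, an orthonormal frame exists at every point, `exists_basis_isOrthonormalFrame`), whence
`T ≤ 4/(2m)` along every Ricci flow from `g₀` (`ricciFlow_singularTime_le_holds`,
`scalarCurvatureWith_leviCivita`) — restrict the immortal flow to `[0, 2/m + 1)` (`IsRicciFlow.mono`) for
the contradiction). Only the `{R ≥ m}` face of `pinchingSet` is used. [S; provable now.]
[cite: Hamilton1982, §14, Thm. 14.1 (p. 296)] [cite: Hamilton1986, §5, 5.2 (p. 164)] -/
theorem stub_maximalFlow :
    ∀ (M : Type) [TopologicalSpace M] [T2Space M] [SecondCountableTopology M]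
      [ChartedSpace (EuclideanSpace ℝ (Fin 4)) M] [IsManifold (𝓡 4) ∞ M] [CompactSpace M]
      [ConnectedSpace M]
      (g₀ : PseudoRiemannianMetric (𝓡 4) ∞ (EuclideanSpace ℝ (Fin 4)) (TangentSpace (𝓡 4) : M → Type _))
      (m c K τ : ℝ), g₀.IsRiemannian → 0 < m →
      (∀ (T : ℝ)
        (g : ℝ → PseudoRiemannianMetric (𝓡 4) ∞ (EuclideanSpace ℝ (Fin 4))
          (TangentSpace (𝓡 4) : M → Type _))
        (cov : ℝ → CovariantDerivative (𝓡 4) (EuclideanSpace ℝ (Fin 4))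
          (TangentSpace (𝓡 4) : M → Type _)),
        IsRicciFlow g cov (Ico 0 T) → (∀ t ∈ Ico 0 T, (g t).IsRiemannian) → g 0 = g₀ →
        ∀ t ∈ Ico 0 T, ∀ (x : M) (e : Fin 4 → TangentSpace (𝓡 4) x),
          (g t).IsOrthonormalFrame x e →
            ((g t).blockA (cov t) x e, (g t).blockB (cov t) x e, (g t).blockC (cov t) x e) ∈
              pinchingSet m c K τ) →
      ∃ (T : ℝ) (g : ℝ → PseudoRiemannianMetric (𝓡 4) ∞ (EuclideanSpace ℝ (Fin 4))
          (TangentSpace (𝓡 4) : M → Type _))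
        (cov : ℝ → CovariantDerivative (𝓡 4) (EuclideanSpace ℝ (Fin 4))
          (TangentSpace (𝓡 4) : M → Type _)),
        IsMaximalRicciFlow g cov T ∧ g 0 = g₀ :=
  -- LANDED: Theorems/EntropyRungChangGurskyYangStubMaximalFlow (worker, p110641).lean
  Summit.SmoothPoincare4.SmoothPoincare4.Theorems.MargerinRails.stub_maximalFlow

/-- **STUB 4b — THE PINCHING SET IN INVARIANT FORM (dictionary).** If the Hamilton blocks of a
Levi-Civita connection of a `C^∞` Riemannian metric on a 4-manifold lie in `pinchingSet m c K τ` in every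
orthonormal frame, then pointwise `m ≤ R` and `|W|² + 2|E|² ≤ K R^{2−τ}`: at each point pick an
orthonormal frame (`exists_basis_isOrthonormalFrame`), pass to `g.leviCivita`
(`blocks_eq_leviCivita_of_isLeviCivita`), and read `tr A + tr C = R` (`scal_blocks_eq`),
`|𝒟|² = Σ W² + 2 Σ E²` (`devNormSq_blocks_eq`) with `|W|²`, `|E|²` the frame values
(`weylNormSq_eq_weylNormSqFrame_four`, `tracelessRicciNormSq_eq_tracelessRicciNormSqFrame_four`). The
cone face `WP ≤ c` is not needed downstream and is dropped. [S; provable now.]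
[cite: Margerin1998, Part I, p. 25] [cite: ChangGurskyYang2003, (0.2)] -/
theorem stub_invariantPinching :
    ∀ (M : Type) [TopologicalSpace M] [T2Space M] [SecondCountableTopology M]
      [ChartedSpace (EuclideanSpace ℝ (Fin 4)) M] [IsManifold (𝓡 4) ∞ M]
      (g : PseudoRiemannianMetric (𝓡 4) ∞ (EuclideanSpace ℝ (Fin 4)) (TangentSpace (𝓡 4) : M → Type _))
      [g.HasLeviCivita]
      (cov : CovariantDerivative (𝓡 4) (EuclideanSpace ℝ (Fin 4)) (TangentSpace (𝓡 4) : M → Type _))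
      (m c K τ : ℝ), g.IsRiemannian → g.IsLeviCivita cov →
      (∀ (x : M) (e : Fin 4 → TangentSpace (𝓡 4) x), g.IsOrthonormalFrame x e →
        (g.blockA cov x e, g.blockB cov x e, g.blockC cov x e) ∈ pinchingSet m c K τ) →
      ∀ x : M, m ≤ g.scalarCurvature x ∧
        g.weylNormSq x + 2 * g.tracelessRicciNormSq x ≤ K * g.scalarCurvature x ^ (2 - τ) :=
  -- LANDED: Theorems/EntropyRungChangGurskyYangStubInvariantPinching (worker, p110603).lean
  Summit.SmoothPoincare4.SmoothPoincare4.Theorems.MargerinRails.stub_invariantPinching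

/-! ## STUB 4 RE-OPENED ALONG HAMILTON'S OWN ROUTE (lead reshape r12, continuation lead c5): the
## 1982 convergence argument on the FIXED compact manifold — no blow-up limit, no compactness theorem

Reshape r12 (2026-08-16, lead c5). The blow-up / round-limit endgame of r5–r11 reduced STUB 4
(`stub_pinchedFlowConvergence` = the bespoke fact `hamilton_convergenceCriterion_four`, Hamilton 1986 §5.2)
to Hamilton's 1995 compactness theorem for Ricci flows (`hamilton_compactness_ricciFlow_slice_four`,
Cheeger–Gromov–Hamilton: harmonic/normal coordinates, injectivity radius from volume, gluing of a limit
MANIFOLD) — an XL leaf nobody works, whose honest split needs flow-uniform Shi constants the tree does not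
carry. Hamilton 1986, §5, p. 164 proves 5.2 differently: "This gives us the required pinching estimate
`|M̊| ≤ C|M|^{1−δ}` … the rest of the proof goes through unchanged" — i.e. Hamilton 1982 §§11–17 /
Huisken 1985 §§4–6, ENTIRELY ON THE FIXED COMPACT MANIFOLD: the gradient estimate for `R` (1982 Thm. 11.1,
Huisken Thm. 4.1: `F = |∇R|²/R + N|E|²`, `∂ₜF ≤ ΔF − |∇R|² + C·R|E|²`, with `|∇E|² ≥ |∇R|²/36` in
dimension 4 = Huisken Lemma 4.3), `R_max/R_min → 1` (1982 Thm. 15.1 — whose geometric half is ALREADY the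
tree theorem `one_sub_mul_le_of_ricci_ge_of_mfderiv_le` over local Myers
`length_mul_sqrt_le_pi_of_isMinimizingUpTo`), the two-sided Type-I bounds `1 ≤ (T−t)R ≤ 3` and the
roundness RATE `|(T−t)R − 2| ≤ C(T−t)^δ` (ODE sandwich for `R_min`, `R_max` from `∂ₜR = ΔR + 2|Ric|²` +
1982 Lemma 17.4's decay of `|∇R|` by the same `F` + Myers' diameter bound), scaled Shi bounds
`|∇ᵏRm|² ≤ C_k (T−t)^{−k−2}` for the ONE flow (the tree's per-flow inequality constants
`IsRicciFlow.derivWithin_curvDerivNormSq_le` are uniform in TIME, and `shi_maxPrinciple_bound` is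
quantitative — no uniformity across flows is needed), and the smooth convergence of `g(t)/(T−t)` to a
`C^∞` Riemannian metric with `Ric = g'/2`, `W = 0`, i.e. constant sectional curvature `1/6` (1982 Lemma
14.2 / §17: `∫ |∂ₜ(g/(T−t))| dt < ∞`; chart Grönwall with integrable coefficients; covariant interpolation
between `|Ric − g/(2(T−t))| → 0` and the Shi bounds; Besse 1.118). The five registered stubs below
(`stub_gradientEstimates` [the PDE heart; LEAD], `stub_curvatureRatio`, `stub_roundnessRate`,
`stub_scaledShi`, `stub_smoothRoundLimit`) make `stub_pinchedFlowConvergence` sorry-free glue again. The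
compactness closure stays LANDED as the alternative (`ChangGurskyYang_of_threeFacts` p124403,
`hamilton_convergenceCriterion_four_of_hamiltonCompactness` p115618; stubs 4c.1–4f landed p110705–p112264):
nothing is lost if this route stalls. Discharging these five stubs proves `hamilton_convergenceCriterion_four`
outright, which is ALSO hypothesis (H1) of the tree's reduction of Hamilton's 1986 classification of closed
4-manifolds with positive curvature operator (`HamiltonPCOClassificationProofs.lean`).

Conventions in the five statements: `R = scalarCurvatureWith (cov t)` (the flow's Levi-Civita witness;
`= scalarCurvature (g t)` by `IsLeviCivita.eq_leviCivita_holds`), `|E|² = normSq Ric − R²/4`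
(`tracelessRicciNormSq_eq_normSq`), `|W|² = |Rm|² − 2 normSq Ric + R²/3` (`weylNormSq_eq_curvNormSqWith`),
`|∇R|² = gradSq`, `|∇ᵏRm|² = curvDerivNormSq`; real powers `(T − t) ^ δ` are `Real.rpow` of the positive
base `T − t`. -/

/-- **STUB 4.B1 — HAMILTON'S GRADIENT ESTIMATES FOR THE SCALAR CURVATURE (the PDE heart; Hamilton 1982,
Thm. 11.1 with Lemmas 11.6–11.9, and Lemma 17.4; Huisken 1985, Thm. 4.1 with Lemma 4.3; dimension 4).**
Along a Ricci flow of Riemannian metrics on `[0, T)` on a closed 4-manifold with the invariant pinching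
`m ≤ R`, `|W|² + 2|E|² ≤ K R^{2−τ}` (STUB 4b output): (i) for every `η > 0` there is `C` with
`|∇R|² ≤ η R³ + C` on `M × [0, T)`; (ii) if moreover `c₁ ≤ (T−t)R ≤ c₂` on `[t₁, T)` with `c₁ > 0`, then
`|∇R|² ≤ C (T−t)^{δ−3}` there for some `δ > 0` (1982 Lemma 17.4 in unnormalised clothes:
`(T−t)²·|∇R|²/R → 0` at a power rate). Both from ONE evolution inequality for
`F = |∇R|²/R + N|E|²`, `N = 144(1 + K m^{−τ})`:  `∂ₜF ≤ ΔF − |∇R|² + C·R·|E|²` — from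
`∂ₜR = ΔR + 2|Ric|²` (tree: `IsRicciFlow.hasDerivWithinAt_scalarCurvatureWith`), `∂ₜ|∇R|² = Δ|∇R|² − 2|∇²R|²
+ 4⟨∇R, ∇|Ric|²⟩` (chart: `hasDerivWithinAt_gradSqAt_ricciFlow`, Bochner `lapAt_gradSqAt`),
`∂ₜ|Ric|² = Δ|Ric|² − 2|∇Ric|² + 4Rm(Ric,Ric)` (chart: `hasDerivWithinAt_ricAt_ricciFlow'`,
`hasDerivWithinAt_tnormSq_ricciFlow`) whence `∂ₜ|E|² = Δ|E|² − 2|∇E|² + 4Rm(E,E) + R|E|²`, Hamilton's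
identity `2⟨∇|∇R|²,∇R⟩/R² − 2|∇R|⁴/R³ − 2|∇²R|²/R = −(2/R³)|R∇²R − ∇R⊗∇R|² ≤ 0`, and the Bianchi
projection `|∇Ric|² ≥ (5/18)|∇R|²`, `|∇E|² = |∇Ric|² − |∇R|²/4 ≥ |∇R|²/36` (chart: `CoordBianchi`); then the
tree's `weakMaximumPrinciple` with the ODE comparisons `φ' = C(η)` for `F − ηR²` (i) and
`φ' = −(c₁/(T−t))φ + C'(T−t)^{τ−3}` for `F` (ii). [L; LEAD.]
[cite: Hamilton1982, §11, Thm. 11.1, Lemmas 11.6–11.9; §17, Lemma 17.4] [cite: Huisken1985, §4, Thm. 4.1, Lemma 4.3] -/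
theorem stub_gradientEstimates :
    ∀ (M : Type) [TopologicalSpace M] [T2Space M] [SecondCountableTopology M]
      [ChartedSpace (EuclideanSpace ℝ (Fin 4)) M] [IsManifold (𝓡 4) ∞ M] [CompactSpace M]
      (g : ℝ → PseudoRiemannianMetric (𝓡 4) ∞ (EuclideanSpace ℝ (Fin 4)) (TangentSpace (𝓡 4) : M → Type _))
      (cov : ℝ → CovariantDerivative (𝓡 4) (EuclideanSpace ℝ (Fin 4)) (TangentSpace (𝓡 4) : M → Type _))
      (T m K τ : ℝ), 0 < T → 0 < m → 0 < K → 0 < τ → τ ≤ 1 →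
      IsRicciFlow g cov (Ico 0 T) → (∀ t ∈ Ico 0 T, (g t).IsRiemannian) →
      (∀ t ∈ Ico 0 T, ∀ [(g t).HasLeviCivita] (x : M),
        m ≤ (g t).scalarCurvature x ∧
          (g t).weylNormSq x + 2 * (g t).tracelessRicciNormSq x ≤
            K * (g t).scalarCurvature x ^ (2 - τ)) →
      (∀ η : ℝ, 0 < η → ∃ C : ℝ, ∀ t ∈ Ico 0 T, ∀ x : M,
        (g t).gradSq (fun y ↦ (g t).scalarCurvatureWith (cov t) y) x ≤
          η * (g t).scalarCurvatureWith (cov t) x ^ 3 + C) ∧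
      (∀ (t₁ c₁ c₂ : ℝ), t₁ ∈ Ico 0 T → 0 < c₁ →
        (∀ t ∈ Ico t₁ T, ∀ x : M, c₁ ≤ (T - t) * (g t).scalarCurvatureWith (cov t) x ∧
          (T - t) * (g t).scalarCurvatureWith (cov t) x ≤ c₂) →
        ∃ δ C : ℝ, 0 < δ ∧ ∀ t ∈ Ico t₁ T, ∀ x : M,
          (g t).gradSq (fun y ↦ (g t).scalarCurvatureWith (cov t) y) x ≤ C * (T - t) ^ (δ - 3)) :=
  -- LANDED (lead c6 + wave 1): Theorems/EntropyRungChangGurskyYangStubGradientEstimates.lean (assembly) over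
  -- …Evolution (p127742, lead), …Smooth (p127527), …Bound (p127842), …Decay (p127847)
  Summit.SmoothPoincare4.SmoothPoincare4.Theorems.MargerinRails.stub_gradientEstimates

/-- **STUB 4.B2 — `R_max/R_min → 1` AS `t → T` (Hamilton 1982, Thm. 15.1; Huisken 1985, §4 end).** For
the maximal (finite-time) flow with the invariant pinching and the gradient estimate (i) of STUB 4.B1: for every
`θ < 1`, `R ≥ θ R_max` everywhere at all late times. Ingredients: `R_max(t) → ∞` as `t → T` (curvature
blow-up at the maximal time, tree: `ricciFlow_curvature_blowup_of_shortTime ricciFlow_shortTime_existence_holds`,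
with `|Rm|² = |W|² + 2|E|² + R²/6 ≤ K R^{2−τ} + R²/6 ≤ (K m^{−τ} + 1/6) R²`, so an unbounded `|Rm|` forces
an unbounded `R`); `Rc ≥ (R/8)·g` wherever `R ≥ R_* = (8√(K/2))^{2/τ}` (`|E(w,w)| ≤ |E|·|w|²`,
`|E|² ≤ K R^{2−τ}/2`); then Hamilton's Thm. 15.1 step VERBATIM the tree's
`one_sub_mul_le_of_ricci_ge_of_mfderiv_le` (`HamiltonCurvatureRatio.lean`: gradient bound
`|dR| ≤ η'² R_max^{3/2}`, `Rc ≥ εRg`, local Myers) except that its Ricci hypothesis is only needed — and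
only available — at points with `R ≥ (1−η')R_max` (re-prove that lemma with the localised hypothesis; same
proof), choosing `η'` with `1 − η' ≥ θ`, `π²·3·η'² < (1/8)(1−η')`, and `t₀` so late that
`η R_max³ + C(η) ≤ η'⁴ R_max³` and `(1−η')R_max ≥ R_*` on `[t₀, T)`. [M; worker.]
[cite: Hamilton1982, §15, Thm. 15.1 and Thm. 15.2] [cite: Huisken1985, §4, p. 61] -/
theorem stub_curvatureRatio :
    ∀ (M : Type) [TopologicalSpace M] [T2Space M] [SecondCountableTopology M]
      [ChartedSpace (EuclideanSpace ℝ (Fin 4)) M] [IsManifold (𝓡 4) ∞ M] [CompactSpace M]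
      [ConnectedSpace M]
      (g : ℝ → PseudoRiemannianMetric (𝓡 4) ∞ (EuclideanSpace ℝ (Fin 4)) (TangentSpace (𝓡 4) : M → Type _))
      (cov : ℝ → CovariantDerivative (𝓡 4) (EuclideanSpace ℝ (Fin 4)) (TangentSpace (𝓡 4) : M → Type _))
      (T m K τ : ℝ), 0 < m → 0 < K → 0 < τ → τ ≤ 1 →
      IsMaximalRicciFlow g cov T →
      (∀ t ∈ Ico 0 T, ∀ [(g t).HasLeviCivita] (x : M),
        m ≤ (g t).scalarCurvature x ∧
          (g t).weylNormSq x + 2 * (g t).tracelessRicciNormSq x ≤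
            K * (g t).scalarCurvature x ^ (2 - τ)) →
      (∀ η : ℝ, 0 < η → ∃ C : ℝ, ∀ t ∈ Ico 0 T, ∀ x : M,
        (g t).gradSq (fun y ↦ (g t).scalarCurvatureWith (cov t) y) x ≤
          η * (g t).scalarCurvatureWith (cov t) x ^ 3 + C) →
      ∀ θ : ℝ, 0 < θ → θ < 1 → ∃ t₀ ∈ Ico 0 T, ∀ t ∈ Ico t₀ T, ∀ x y : M,
        θ * (g t).scalarCurvatureWith (cov t) y ≤ (g t).scalarCurvatureWith (cov t) x :=
  -- LANDED (worker c5-W, p126761; Aux p126633): Theorems/EntropyRungChangGurskyYangStubCurvatureRatio.lean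
  Summit.SmoothPoincare4.SmoothPoincare4.Theorems.MargerinRails.stub_curvatureRatio

/-- **STUB 4.B3 — TYPE-I BOUNDS AND THE ROUNDNESS RATE (Hamilton 1982, §16 with Lemma 17.2/Cor. 17.3/17.5,
in unnormalised clothes).** For the maximal pinched flow with `R_max/R_min → 1` (STUB 4.B2 output) and the
decay estimate (ii) of STUB 4.B1: at late times `|(T−t)R − 2| ≤ C(T−t)^δ`, `(T−t)²|E|² ≤ C(T−t)^{2δ}`,
`(T−t)²|W|² ≤ C(T−t)^δ` and `|Rm|² ≤ C(T−t)^{−2}`. Proof: (a) `R_min(t) ≤ 2/(T−t)` — by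
`ricciFlow_scalarCurvature_lowerBound_holds` restarted at `t` (`∂ₜR ≥ ΔR + R²/2`), the comparison solution
`R_min(t)/(1 − R_min(t)(s−t)/2)` must stay finite up to `T`; (b) for `ε > 0` and `t` late (so that
`2|E|² ≤ εR²` by pinching + `R_min → ∞`), `∂ₜR ≤ ΔR + (1/2 + ε)R²` and the tree's `weakMaximumPrinciple` with
`φ' = (1/2+ε)φ²` plus `R_max → ∞` give `R_max(t) ≥ 2/((1+2ε)(T−t))`; with the ratio bound: `1 ≤ (T−t)R ≤ 3`
eventually, hence `|Rm|² ≤ (K·3^{2−τ}(T−t)^{τ} + 3²/6)(T−t)^{−2}`, `(T−t)²(|W|² + 2|E|²) ≤ K 3^{2−τ}(T−t)^τ`;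
(c) feed `c₁ = 1, c₂ = 3` into (ii): `|∇R| ≤ C(T−t)^{(δ−3)/2}`; Myers (tree:
`edist_le_pi_div_sqrt_of_ricci_ge_of_compactSpace`, `Rc ≥ (R_min/8) g ≥ (8(T−t))^{−1} g`) gives
`diam ≤ C(T−t)^{1/2}`, and `abs_sub_le_mul_of_mfderiv_le` along minimizing geodesics gives
`R_max − R_min ≤ C(T−t)^{δ/2−1}`; (d) with (a),(b) (now `ε = ε(t) ≤ C(T−t)^τ`):
`|(T−t)R − 2| ≤ C(T−t)^{min(τ, δ/2)}`. [M; worker.]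
[cite: Hamilton1982, §16, Lemmas 16.1–16.5; §17, Lemma 17.2, Cor. 17.3, Cor. 17.5] [cite: Huisken1985, §5] -/
theorem stub_roundnessRate :
    ∀ (M : Type) [TopologicalSpace M] [T2Space M] [SecondCountableTopology M]
      [ChartedSpace (EuclideanSpace ℝ (Fin 4)) M] [IsManifold (𝓡 4) ∞ M] [CompactSpace M]
      [ConnectedSpace M]
      (g : ℝ → PseudoRiemannianMetric (𝓡 4) ∞ (EuclideanSpace ℝ (Fin 4)) (TangentSpace (𝓡 4) : M → Type _))
      (cov : ℝ → CovariantDerivative (𝓡 4) (EuclideanSpace ℝ (Fin 4)) (TangentSpace (𝓡 4) : M → Type _))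
      (T m K τ : ℝ), 0 < m → 0 < K → 0 < τ → τ ≤ 1 →
      IsMaximalRicciFlow g cov T →
      (∀ t ∈ Ico 0 T, ∀ [(g t).HasLeviCivita] (x : M),
        m ≤ (g t).scalarCurvature x ∧
          (g t).weylNormSq x + 2 * (g t).tracelessRicciNormSq x ≤
            K * (g t).scalarCurvature x ^ (2 - τ)) →
      (∀ (t₁ c₁ c₂ : ℝ), t₁ ∈ Ico 0 T → 0 < c₁ →
        (∀ t ∈ Ico t₁ T, ∀ x : M, c₁ ≤ (T - t) * (g t).scalarCurvatureWith (cov t) x ∧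
          (T - t) * (g t).scalarCurvatureWith (cov t) x ≤ c₂) →
        ∃ δ C : ℝ, 0 < δ ∧ ∀ t ∈ Ico t₁ T, ∀ x : M,
          (g t).gradSq (fun y ↦ (g t).scalarCurvatureWith (cov t) y) x ≤ C * (T - t) ^ (δ - 3)) →
      (∀ θ : ℝ, 0 < θ → θ < 1 → ∃ t₀ ∈ Ico 0 T, ∀ t ∈ Ico t₀ T, ∀ x y : M,
        θ * (g t).scalarCurvatureWith (cov t) y ≤ (g t).scalarCurvatureWith (cov t) x) →
      ∃ δ C t₀ : ℝ, 0 < δ ∧ 0 ≤ C ∧ t₀ ∈ Ico 0 T ∧ ∀ t ∈ Ico t₀ T, ∀ x : M,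
        |(T - t) * (g t).scalarCurvatureWith (cov t) x - 2| ≤ C * (T - t) ^ δ ∧
        (T - t) ^ 2 * ((g t).normSq x ((cov t).ricci x) -
            (g t).scalarCurvatureWith (cov t) x ^ 2 / 4) ≤ C * (T - t) ^ (2 * δ) ∧
        (T - t) ^ 2 * ((g t).curvNormSqWith (cov t) x - 2 * (g t).normSq x ((cov t).ricci x) +
            (g t).scalarCurvatureWith (cov t) x ^ 2 / 3) ≤ C * (T - t) ^ δ ∧
        (g t).curvNormSqWith (cov t) x ≤ C * ((T - t) ^ 2)⁻¹ :=
  -- LANDED (worker c5-W, p127038; Aux p126845, p126919): Theorems/EntropyRungChangGurskyYangStubRoundnessRate.lean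
  Summit.SmoothPoincare4.SmoothPoincare4.Theorems.MargerinRails.stub_roundnessRate

/-- **STUB 4.B4 — SCALED SHI ESTIMATES FOR ONE TYPE-I FLOW (Shi 1989 / Hamilton 1982 §13 as in Topping
2006, Thm. 3.3.1; Hamilton 1995, §16).** A Ricci flow of Riemannian metrics on `[0, T)` on a closed manifold
with `|Rm|² ≤ C₀(T−t)^{−2}` at late times has `|∇ᵏRm|² ≤ C_k(T−t)^{−k−2}` at late times, for every `k`.
Proof: the flow's OWN inequality constants (`IsRicciFlow.derivWithin_curvDerivNormSq_le`, one constant per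
`k`, valid for ALL `t ∈ [0, T)`) feed the quantitative maximum principle `shi_maxPrinciple_bound` (universal
`shiConst`) on the windows `[t − (T−t)/A, t] ⊂ [t₀, T)`, `A = max 1 √(4C₀)`, where
`|Rm|² ≤ 4C₀(T−t)^{−2} =: M₀²` and `M₀·((T−t)/A) ≤ 1`; time shifts by `curvDerivNormSq_comp_add_const` /
`IsRicciFlow.comp_add_const`; the extra `C√U₀U_k` term is absorbed exactly as in the tree's proof of
`IsRicciFlow.curvDerivNormSq_le_of_curvatureBoundedBy`. No uniformity across different flows is used.
[M; worker.] [cite: Topping2006, §3.3, Thm. 3.3.1] [cite: Hamilton1982, §13, Thm. 13.4 and §14, Lemma 14.4] -/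
theorem stub_scaledShi :
    ∀ (M : Type) [TopologicalSpace M] [T2Space M] [SecondCountableTopology M]
      [ChartedSpace (EuclideanSpace ℝ (Fin 4)) M] [IsManifold (𝓡 4) ∞ M] [CompactSpace M]
      (g : ℝ → PseudoRiemannianMetric (𝓡 4) ∞ (EuclideanSpace ℝ (Fin 4)) (TangentSpace (𝓡 4) : M → Type _))
      (cov : ℝ → CovariantDerivative (𝓡 4) (EuclideanSpace ℝ (Fin 4)) (TangentSpace (𝓡 4) : M → Type _))
      (T : ℝ), 0 < T → IsRicciFlow g cov (Ico 0 T) → (∀ t ∈ Ico 0 T, (g t).IsRiemannian) →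
      ∀ (C₀ t₀ : ℝ), t₀ ∈ Ico 0 T →
      (∀ t ∈ Ico t₀ T, ∀ x : M, (g t).curvNormSqWith (cov t) x ≤ C₀ * ((T - t) ^ 2)⁻¹) →
      ∀ k : ℕ, ∃ C t₁ : ℝ, t₁ ∈ Ico 0 T ∧ ∀ t ∈ Ico t₁ T, ∀ z : M,
        curvDerivNormSq (𝓡 4) g k t z ≤ C * ((T - t) ^ (k + 2))⁻¹ :=
  -- LANDED (worker c5-W, p126273): Theorems/EntropyRungChangGurskyYangStubScaledShi.lean
  Summit.SmoothPoincare4.SmoothPoincare4.Theorems.MargerinRails.stub_scaledShi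

/-- **STUB 4.B5 — THE SCALED METRICS `g(t)/(T−t)` CONVERGE SMOOTHLY TO A ROUND METRIC (Hamilton 1982,
§14, Lemma 14.2 and §17, Thm. 17.6–Cor. 17.11; Besse 1987, 1.118).** A Ricci flow of Riemannian metrics on
`[0, T)` on a closed connected 4-manifold with the roundness rate `|(T−t)R − 2| ≤ C(T−t)^δ`,
`(T−t)²|E|² ≤ C(T−t)^{2δ}`, `(T−t)²|W|² ≤ C(T−t)^δ` and scaled Shi bounds of all orders converges, after the
scaling `g̃(t) = g(t)/(T−t)`, to a `C^∞` Riemannian metric `g'` of constant sectional curvature `1/6` (any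
`k > 0` is all the line needs). Proof: `∂ₜg̃ = (g̃ − 2Ric)/(T−t)` and
`|g − 2(T−t)Ric|²_g = ((T−t)R − 2)² + 4(T−t)²|E|² ≤ 5C(T−t)^{2δ}`, so `∫^T |∂ₜg̃|_{g̃} dt < ∞`: the `g̃(t)`
are uniformly equivalent and converge uniformly to a continuous positive-definite `g'` (1982 Lemma 14.2, cf.
the tree's `IsRicciFlow.exists_limitMetric_of_curvatureBoundedBy`); covariant interpolation on the compact
`(M, g̃(t))` (Landau–Kolmogorov along unit geodesics in parallel frames, tree `ParallelTransport.lean`)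
between `|Ric − g̃/2|_{g̃} ≤ C(T−t)^δ` and the scaled Shi bounds `|∇̃ʲRic|_{g̃} ≤ C_j` gives
`|∇̃ʲRic|_{g̃} ≤ C(T−t)^{δ_j}`, `δ_j > 0`, for `j ≥ 1`; in charts, `∂ₜ∂^αg̃ᵢⱼ = ∂^α(g̃ − 2Ric)ᵢⱼ/(T−t)`
expands in `∇̃^{≤|α|}(g̃ − 2Ric)` (decaying) against `∂^{<|α|}Γ` (lower order), a linear Grönwall system with
integrable coefficients: all spatial chart derivatives of `g̃` stay bounded and converge, so `g'` is `C^∞`,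
Riemannian, and `g̃ → g'` in every `Cᵏ` (tree pattern: `contMDiffOn_extendVal` / `limitMetric` of
`RicciFlowSmoothExtension.lean`, `CkArzelaAscoli`); curvature passes to the limit: `Ric(g') = g'/2`,
`|W(g')|² = lim (T−t)²|W|² = 0`, whence `K ≡ 1/6` by `hasConstantSectionalCurvature_of_ricci_eq_of_weylFrame_eq_zero`
(no Schur needed: the Einstein constant is already the number `1/2`). [L; worker + helpers.]
[cite: Hamilton1982, §14, Lemma 14.2; §17, Thm. 17.6, Cor. 17.10, Cor. 17.11] [cite: Besse1987, 1.118] -/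
theorem stub_smoothRoundLimit :
    ∀ (M : Type) [TopologicalSpace M] [T2Space M] [SecondCountableTopology M]
      [ChartedSpace (EuclideanSpace ℝ (Fin 4)) M] [IsManifold (𝓡 4) ∞ M] [CompactSpace M]
      [ConnectedSpace M]
      (g : ℝ → PseudoRiemannianMetric (𝓡 4) ∞ (EuclideanSpace ℝ (Fin 4)) (TangentSpace (𝓡 4) : M → Type _))
      (cov : ℝ → CovariantDerivative (𝓡 4) (EuclideanSpace ℝ (Fin 4)) (TangentSpace (𝓡 4) : M → Type _))
      (T : ℝ), 0 < T → IsRicciFlow g cov (Ico 0 T) → (∀ t ∈ Ico 0 T, (g t).IsRiemannian) →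
      ∀ (δ C t₀ : ℝ), 0 < δ → t₀ ∈ Ico 0 T →
      (∀ t ∈ Ico t₀ T, ∀ x : M,
        |(T - t) * (g t).scalarCurvatureWith (cov t) x - 2| ≤ C * (T - t) ^ δ ∧
        (T - t) ^ 2 * ((g t).normSq x ((cov t).ricci x) -
            (g t).scalarCurvatureWith (cov t) x ^ 2 / 4) ≤ C * (T - t) ^ (2 * δ) ∧
        (T - t) ^ 2 * ((g t).curvNormSqWith (cov t) x - 2 * (g t).normSq x ((cov t).ricci x) +
            (g t).scalarCurvatureWith (cov t) x ^ 2 / 3) ≤ C * (T - t) ^ δ) →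
      (∀ k : ℕ, ∃ C' t₁ : ℝ, t₁ ∈ Ico 0 T ∧ ∀ t ∈ Ico t₁ T, ∀ z : M,
        curvDerivNormSq (𝓡 4) g k t z ≤ C' * ((T - t) ^ (k + 2))⁻¹) →
      ∃ (k : ℝ) (g' : PseudoRiemannianMetric (𝓡 4) ∞ (EuclideanSpace ℝ (Fin 4))
          (TangentSpace (𝓡 4) : M → Type _)),
        0 < k ∧ g'.IsRiemannian ∧ g'.HasConstantSectionalCurvature k :=
  -- LANDED (lead c6 + waves 2–3): Theorems/EntropyRungChangGurskyYangStubSmoothRoundLimit.lean (assembly) over the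
  -- layers …Defect p130034, …Window p128927, …DecayOne p129772, …DecayAll p129815, …ChartData p129384,
  -- …ChartBounds p130093, …LimitMetric p129422, …LimitRound p130673
  Summit.SmoothPoincare4.SmoothPoincare4.Theorems.MargerinRails.stub_smoothRoundLimit

/-- **STUB 4 — THE ENDGAME, A THEOREM OF THE LINE MODULO STUBS 4a, 4b, 4.B1–4.B5** (registered statement
UNCHANGED: a `β`-pinched Ricci flow on a closed connected 4-manifold yields a metric of constant positive
sectional curvature; Hamilton 1986, criterion 5.2 for `pinchingSet m c K τ` = Margerin 1998 Part VI).
Proof (reshape r12 = Hamilton 1982 §§11–17 on the fixed manifold): `stub_maximalFlow` (finite maximal flow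
from `g₀`) → `stub_invariantPinching` along it (the STUB-3 output fed in through the hypothesis) →
`stub_gradientEstimates` → `stub_curvatureRatio` → `stub_roundnessRate` → `stub_scaledShi` →
`stub_smoothRoundLimit`. The earlier closures of this stub (modulo `hamilton_convergenceCriterion_four`, p84954;
modulo the blow-up limit / Hamilton's compactness theorem, p113080 / p115618 / p124403) remain valid and unused
here. [cite: Hamilton1986, §5, 5.2 (p. 164)] [cite: Hamilton1982, §§11–17] [cite: Margerin1998, Part VI, pp. 53–57] -/
theorem stub_pinchedFlowConvergence :
    ∀ (M : Type) [TopologicalSpace M] [T2Space M] [SecondCountableTopology M]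
      [ChartedSpace (EuclideanSpace ℝ (Fin 4)) M] [IsManifold (𝓡 4) ∞ M] [CompactSpace M]
      [ConnectedSpace M]
      (g₀ : PseudoRiemannianMetric (𝓡 4) ∞ (EuclideanSpace ℝ (Fin 4)) (TangentSpace (𝓡 4) : M → Type _))
      (m c K τ : ℝ), g₀.IsRiemannian → 0 < m → 0 < c → c < 1 / 6 → 0 < K → 0 < τ → τ ≤ 1 →
      (∀ (cov : CovariantDerivative (𝓡 4) (EuclideanSpace ℝ (Fin 4)) (TangentSpace (𝓡 4) : M → Type _)),
        g₀.IsLeviCivita cov →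
        ∀ (x : M) (e : Fin 4 → TangentSpace (𝓡 4) x), g₀.IsOrthonormalFrame x e →
          (g₀.blockA cov x e, g₀.blockB cov x e, g₀.blockC cov x e) ∈ pinchingSet m c K τ) →
      (∀ (T : ℝ)
        (g : ℝ → PseudoRiemannianMetric (𝓡 4) ∞ (EuclideanSpace ℝ (Fin 4))
          (TangentSpace (𝓡 4) : M → Type _))
        (cov : ℝ → CovariantDerivative (𝓡 4) (EuclideanSpace ℝ (Fin 4))
          (TangentSpace (𝓡 4) : M → Type _)),
        IsRicciFlow g cov (Ico 0 T) → (∀ t ∈ Ico 0 T, (g t).IsRiemannian) → g 0 = g₀ →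
        ∀ t ∈ Ico 0 T, ∀ (x : M) (e : Fin 4 → TangentSpace (𝓡 4) x),
          (g t).IsOrthonormalFrame x e →
            ((g t).blockA (cov t) x e, (g t).blockB (cov t) x e, (g t).blockC (cov t) x e) ∈
              pinchingSet m c K τ) →
      ∃ (k : ℝ) (g' : PseudoRiemannianMetric (𝓡 4) ∞ (EuclideanSpace ℝ (Fin 4))
          (TangentSpace (𝓡 4) : M → Type _)),
        0 < k ∧ g'.IsRiemannian ∧ g'.HasConstantSectionalCurvature k := by
  intro M _ _ _ _ _ _ _ g₀ m c K τ hg₀ hm hc0 hc hK hτ0 hτ1 hfit hflows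
  -- 4a: the maximal flow from `g₀` is finite-time
  obtain ⟨T, g, cov, hmax, h0⟩ := stub_maximalFlow M g₀ m c K τ hg₀ hm hflows
  have hT : 0 < T := hmax.pos
  -- 4b: the pinching along the maximal flow, in invariant form
  have hpinch : ∀ s ∈ Ico 0 T, ∀ [(g s).HasLeviCivita] (x : M),
      m ≤ (g s).scalarCurvature x ∧
        (g s).weylNormSq x + 2 * (g s).tracelessRicciNormSq x ≤
          K * (g s).scalarCurvature x ^ (2 - τ) := by
    intro s hs _ x
    exact stub_invariantPinching M (g s) (cov s) m c K τ (hmax.isRiemannian s hs)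
      (hmax.isRicciFlow.isLeviCivita s hs)
      (fun y e he ↦ hflows T g cov hmax.isRicciFlow hmax.isRiemannian h0 s hs y e he) x
  -- 4.B1: the gradient estimate (11.1) and the gradient decay (17.4)
  obtain ⟨hgrad, hdecay⟩ := stub_gradientEstimates M g cov T m K τ hT hm hK hτ0 hτ1 hmax.isRicciFlow
    hmax.isRiemannian hpinch
  -- 4.B2: `R_max / R_min → 1`
  have hratio := stub_curvatureRatio M g cov T m K τ hm hK hτ0 hτ1 hmax hpinch hgrad
  -- 4.B3: Type-I bounds and the roundness rate
  obtain ⟨δ, C, t₀, hδ, -, ht₀, hround⟩ :=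
    stub_roundnessRate M g cov T m K τ hm hK hτ0 hτ1 hmax hpinch hdecay hratio
  -- 4.B4: scaled Shi bounds for this one flow
  have hshi := stub_scaledShi M g cov T hT hmax.isRicciFlow hmax.isRiemannian C t₀ ht₀
    (fun t ht x ↦ (hround t ht x).2.2.2)
  -- 4.B5: smooth convergence of `g(t)/(T−t)` to a round metric
  exact stub_smoothRoundLimit M g cov T hT hmax.isRicciFlow hmax.isRiemannian δ C t₀ hδ ht₀
    (fun t ht x ↦ ⟨(hround t ht x).1, (hround t ht x).2.1, (hround t ht x).2.2.1⟩) hshi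

/-- **STUB 5 — THE CHERN–GAUSS–BONNET FORMULA IN DIMENSION FOUR (named fact
`Literature.Geometry.Riemannian.chernGaussBonnet_four`, VERBATIM the leaf `hCGB` of
`changGurskyYang_sphere_four_of_chernGaussBonnet_of_margerin_of_thm14` (Euler file); classical XL debt,
already registered as STUB 5 of line `cgy-variance-pivot` of crux CompactShrinkerGap — same call site
`stub_chernGaussBonnetFour M g hg`).** `8π² χ(M) = ¼ (∫|W|² dV).toReal + ∫σ₂(A) dV` for every `C^∞`
Riemannian metric on a closed smooth 4-manifold, `χ(M) = relEuler ℤ ℤ M ∅` (Chern 1944; Besse 1987,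
6.31; CGY 2003 (1.1)); five equivalent forms in `ChernGaussBonnetFourForms.lean`, checked on the round
`S⁴`. DISCHARGED (reshape r4, 2026-08-16): the tree PROVES the fact — `chernGaussBonnet_four_holds`
(`ChernGaussBonnetFourProofs.lean`: Morse function, Chern's field `X` with `div X = Pf(Ω)` off the
critical points, flux `−4π² sign det L` at each critical point, `Σ_p (−1)^{index} = χ(M)`, and the
splitting `Pf(Ω) = ⅛|W|² + ½σ₂(A)`); this stub is now a one-line call and carries no `sorry`.
[cite: Besse1987, 6.31] [cite: ChangGurskyYang2003, (1.1) p. 111] [cite: Chern1944, §§1–2] -/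
theorem stub_chernGaussBonnetFour : chernGaussBonnet_four :=
  -- PROVED IN THE TREE: Literature/Geometry/Riemannian/ChernGaussBonnetFourProofs.lean
  chernGaussBonnet_four_holds

/-! ## STUB 6 OPENED (lead reshape r9, continuation lead c3): CGY Thm. 1.4 from the four Gursky–Viaclovsky facts

STUB 6 `stub_thm14Psc` (≡ `changGurskyYang_theorem14_four`, the σ₂ leaf) is now sorry-free GLUE: line
`gv-continuity-path` (lead c1) proved `changGurskyYang_theorem14_four_of_gvPathFacts` (p108727) — Thm. 1.4 in the
connected `Y > 0` form from the four weighted-path facts of Gursky–Viaclovsky 2003 §3–§5 (a priori `C¹`, `C²`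
estimates, openness, closedness of the solvable set), everything else of the continuity method (start at `t = −∞`
surrogate `t₀ ≪ 0` via `stub_pathHarnack` p97575, the `C⁰` bound `GurskyViaclovskyC0Estimate`, the sign invariant
`κ_t` `GurskyViaclovskyKappaInvariance`, smoothness, the Yamabe-positive conformal representative) being THEOREMS of
the tree — and `stub_thm14Psc_of_theorem14` (p83080) turns the fact into the registered signature. The four facts
are registered below as one-fact stubs; each closes by `exact X_holds` when its `…Proofs.lean` lands upstream. -/

/-- **STUB 6a — GURSKY–VIACLOVSKY A PRIORI `C¹` ESTIMATE along the Weyl-weighted `σ₂` path (named fact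
`Literature.Geometry.Riemannian.gurskyViaclovsky_gradientEstimate_weighted_four`, `GurskyViaclovskyC1Estimate.lean`,
p104676; Gursky–Viaclovsky 2003 Prop. 5 with Lemma 2, Chen 2005 Thm. 1(a)/Cor. 2: `|∇u|²_g ≤ C₁(M, g, q, δ, C₀)`
for smooth admissible solutions at `t ∈ [δ, 1]` with `u ≤ C₀`).** DISCHARGED (reshape r11, lead c4): the tree PROVES the
fact — `gurskyViaclovsky_gradientEstimate_weighted_four_holds` (`GurskyViaclovskyC1EstimateProofs.lean`: maximum principle for
`|∇u|²_g` at a maximum point read in a chart, in an orthonormal eigenframe of the Hessian; GV Lemma 2 = cone algebra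
`CoordSigma2GradientAlgebra.lean`; Glaeser's inequality for the weight `|W_g|²`). This stub is now a one-line call and
carries no `sorry`. [cite: GurskyViaclovsky2003, Prop. 5 and Lemma 2] [cite: Chen2005, Thm. 1(a), Cor. 2] -/
theorem stub_gvGradient : gurskyViaclovsky_gradientEstimate_weighted_four :=
  gurskyViaclovsky_gradientEstimate_weighted_four_holds

/-- **STUB 6b — GURSKY–VIACLOVSKY A PRIORI `C²` ESTIMATE along the weighted path (named fact
`Literature.Geometry.Riemannian.gurskyViaclovsky_hessianEstimate_weighted_four`, `GurskyViaclovskyC2Estimate.lean`,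
p99118; GV 2003 Prop. 6, Chen 2005 §3).** DISCHARGED (r10): the tree PROVES the fact —
`gurskyViaclovsky_hessianEstimate_weighted_four_holds` (`GurskyViaclovskyC2EstimateProofs.lean`: reduction of the Hessian bound to
Chen's Laplacian upper bound `Δ_g u ≤ C₃`, `hessianEstimate_of_dalembertianEstimate`, and the Laplacian bound itself by the
maximum principle for `H = Δu + |∇u|²` with the once/twice differentiated equation in charts, `dalembertian_le_of_isPathSolution`).
This stub is now a one-line call and carries no `sorry`.
[cite: GurskyViaclovsky2003, Prop. 6] [cite: Chen2005, Thm. 1(a) and §3] -/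
theorem stub_gvHessian : gurskyViaclovsky_hessianEstimate_weighted_four :=
  -- DISCHARGED (reshape r10): PROVED IN THE TREE, Literature/Geometry/Riemannian/GurskyViaclovskyC2EstimateProofs.lean
  gurskyViaclovsky_hessianEstimate_weighted_four_holds

/-! ## STUB 6c OPENED (lead reshape r17, continuation lead c8): GV openness from five analytic stubs

STUB 6c `stub_gvOpen` (≡ the named fact `gurskyViaclovsky_pathOpen_weighted_four`, Gursky–Viaclovsky 2003 Prop. 2 + §5:
the solvable set of the weighted `σ₂` path is open below `t = 1`) is no longer a `sorry`: it is GLUE over five registered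
stubs living in the Banach spaces `X = C^{2,α}_𝔄(M)`, `Y = C^{0,α}_𝔄(M)` of the tree
(`Literature.Analysis.FunctionSpaces.HolderManifoldFunction 𝔄 ℝ k α`, Hölder chart data `𝔄`, `α = 1/2`) and the landed
skeleton of the openness step (`GurskyViaclovskyOpennessProofs.lean`: dictionary `solvable_iff_exists_background`, the implicit
function theorem `exists_solution_nhds_of_hasStrictFDerivAt`, persistence `eventually_forall_pos_of_tendstoUniformly`,
`solvable_of_background`, `exists_Ioo_of_eventually_nhds`):

* STUB O1 `stub_pathMapStrictFDeriv` — the zero-finding map `Φ(t, w) = F_t(w) − q e^{−4w}`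
  (`F_t = backgroundPathOperator g t`) IS a map `ℝ × X → Y`, strictly differentiable everywhere, whose partial derivative in
  `w` is, pointwise, the tree's linearisation `𝓛_{t,w}φ + 4q e^{−4w}φ` (`linearisedBackgroundOperator`,
  `hasDerivAt_backgroundPathOperator`) [Nemytskii operators on chart Hölder spaces, `ContDiffHolderNemytskii.lean`];
* STUB O2 `stub_linearisedInvertible` — at a smooth admissible solution with `t ≤ 1`, every bounded `L : X →L Y` with that
  pointwise formula is invertible (GV Prop. 2: injective by `eq_zero_of_linearised_eq_zero`; onto by the global Schauder
  estimate `exists_schauder_global`, the a-priori `C⁰` bound `mul_abs_le_of_maximumPrinciple` and the method of continuity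
  `MethodOfContinuity.lean` from the model isomorphism `Δ_g − 1`, STUB O5);
* STUB O3 `stub_regularity` — "classical elliptic regularity theory" (§5): an admissible `C^{2,α}_𝔄` solution with `t ≤ 1` is
  `C^∞` (difference quotients + interior Schauder, Gilbarg–Trudinger Lemma 17.16, regularity half);
* STUB O4 `stub_backgroundScalarTendsto` — `X`-convergence gives uniform convergence of `backgroundScalar`
  (`= R_g − 6Δ_g w − 6|dw|²_g`), so admissibility persists along the implicit-function family;
* STUB O5 `stub_modelEstimate` — the Schauder estimate `‖u‖_{C^{2,α}_𝔄} ≤ C‖(Δ_g − 1)u‖_{C^{0,α}_𝔄}` (= hypothesis `hest` of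
  the tree's `exists_modelOperator_continuousLinearEquiv_of_estimate`; from `exists_schauder_global` + the maximum principle),
  consumed by STUB O2.
[cite: GurskyViaclovsky2003, Prop. 2 and §5] [cite: GilbargTrudinger2001, Thm. 5.2, Thm. 6.2, Lemma 17.16, Thm. 17.6] -/

section OpennessStubs

open Literature.Analysis.FunctionSpaces Literature.Geometry.Riemannian.GurskyViaclovskyPath
open scoped NNReal

/-- **STUB O5 — THE SCHAUDER ESTIMATE FOR THE MODEL OPERATOR `Δ_g − 1` on `C^{2,α}_𝔄(M)`** (Gilbarg–Trudinger
Thm. 6.2 patched over the charts = the tree's `exists_schauder_global`, specialised to the chart representation of `Δ_g`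
(`dalembertianPieceCLM_apply_eq`, coefficients `gramInv`, `firstOrderCoeff`, smooth on the chart targets, uniformly elliptic for
Riemannian `g` on the compact thickenings), plus the a-priori bound `sup|u| ≤ sup|(Δ_g − 1)u|` of the maximum principle
(`mul_abs_le_of_maximumPrinciple` with `P = g`, `c = −1`) and `‖f x‖ ≤ card ι · ‖f‖` (`norm_apply_le`)). This is exactly the
hypothesis `hest` of `exists_modelOperator_continuousLinearEquiv_of_estimate` (`HolderManifoldModelIsomorphism.lean`), which
then makes `L₀ = Δ_g − 1 : C^{2,α}_𝔄 ≃L C^{0,α}_𝔄` — the reference operator of the method of continuity in STUB O2.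
[cite: GilbargTrudinger2001, Thm. 6.2 and §6.3, Thm. 6.14] -/
theorem stub_modelEstimate :
    ∀ (M : Type) [TopologicalSpace M] [T2Space M] [ChartedSpace (EuclideanSpace ℝ (Fin 4)) M]
      [IsManifold (𝓡 4) ∞ M] [CompactSpace M] {ι : Type} [Fintype ι]
      (𝔄 : HolderChartData ι (EuclideanSpace ℝ (Fin 4)) M)
      (g : PseudoRiemannianMetric (𝓡 4) ∞ (EuclideanSpace ℝ (Fin 4)) (TangentSpace (𝓡 4) : M → Type _))
      [g.HasLeviCivita], g.IsRiemannian → ∀ {α : ℝ≥0}, 0 < α → ∀ (hα1 : α < 1),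
      ∃ C : ℝ, ∀ u : HolderManifoldFunction 𝔄 ℝ (0 + 2) α, ‖u‖ ≤ C * ‖modelOperatorCLM 𝔄 g hα1.le u‖ :=
  -- DISCHARGED (r18): Theorems/EntropyRungChangGurskyYangStubModelEstimate.lean (wave 1, p164915)
  Summit.SmoothPoincare4.SmoothPoincare4.Theorems.MargerinRails.stub_modelEstimate

/-- **STUB O1 — THE ZERO-FINDING MAP `Φ(t, w) = F_t(w) − q e^{−4w}` IS STRICTLY DIFFERENTIABLE `ℝ × C^{2,α}_𝔄 → C^{0,α}_𝔄`
WITH `∂_w Φ = 𝓛_{t,w} + 4q e^{−4w}`** (Gursky–Viaclovsky 2003, proof of Prop. 2: "Define `u_s = u + sφ`, then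
`𝓛^t(φ) = d/ds F_t[x, u_s, ∇u_s, ∇²u_s]|_{s=0}`", and §5, the hypothesis of the implicit function theorem in
`C^{2,α} × ℝ → C^{α}`). In each chart `j` of `𝔄` the function `F_t(w) ∘ chart_j⁻¹` is a fixed polynomial in the 2-jet of
`w ∘ chart_j⁻¹`, in `e^{−4w}` and in smooth coefficient functions of the chart point (metric, Christoffels, curvature, `q`), so
`Φ` is assembled from the tree's bounded chart restriction / extension (`chartRestrictCLM`, `chartExtendCLM`), the jet maps
`fderivCLM`, `fderiv₂CLM`, products `bilinearCLM` and the smooth superposition operators `contDiff_compLeft`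
(`ContDiffHolderNemytskii.lean`); the pointwise identification of `∂_wΦ` is `hasDerivAt_backgroundPathOperator` composed with the
(continuous, linear) point evaluations. [cite: GurskyViaclovsky2003, §2 proof of Prop. 2 and §5]
[cite: GilbargTrudinger2001, Thm. 17.6] -/
theorem stub_pathMapStrictFDeriv :
    ∀ (M : Type) [TopologicalSpace M] [T2Space M] [ChartedSpace (EuclideanSpace ℝ (Fin 4)) M]
      [IsManifold (𝓡 4) ∞ M] [CompactSpace M] {ι : Type} [Fintype ι]
      (𝔄 : HolderChartData ι (EuclideanSpace ℝ (Fin 4)) M)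
      (g : PseudoRiemannianMetric (𝓡 4) ∞ (EuclideanSpace ℝ (Fin 4)) (TangentSpace (𝓡 4) : M → Type _))
      [g.HasLeviCivita], g.IsRiemannian →
      ∀ (q : M → ℝ), ContMDiff (𝓡 4) 𝓘(ℝ) ∞ q → ∀ {α : ℝ≥0} (_hα : α ≤ 1),
      ∃ Φ : ℝ × HolderManifoldFunction 𝔄 ℝ 2 α → HolderManifoldFunction 𝔄 ℝ 0 α,
        (∀ (t : ℝ) (w : HolderManifoldFunction 𝔄 ℝ 2 α) (x : M),
          Φ (t, w) x = backgroundPathOperator g t w x - q x * Real.exp (-4 * w x)) ∧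
        ∀ (t : ℝ) (w : HolderManifoldFunction 𝔄 ℝ 2 α),
          ∃ Φ' : ℝ × HolderManifoldFunction 𝔄 ℝ 2 α →L[ℝ] HolderManifoldFunction 𝔄 ℝ 0 α,
            HasStrictFDerivAt Φ Φ' (t, w) ∧
            ∀ (φ : HolderManifoldFunction 𝔄 ℝ 2 α) (x : M),
              Φ' ((0 : ℝ), φ) x =
                linearisedBackgroundOperator g t w φ x + 4 * q x * Real.exp (-4 * w x) * φ x :=
  Summit.SmoothPoincare4.SmoothPoincare4.Theorems.MargerinRails.stub_pathMapStrictFDeriv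

/-- **STUB O2 — GURSKY–VIACLOVSKY PROP. 2: THE LINEARISATION AT A SMOOTH ADMISSIBLE SOLUTION WITH `t ≤ 1` IS AN
ISOMORPHISM `C^{2,α}_𝔄 → C^{0,α}_𝔄`.** Every bounded `L : X →L Y` acting pointwise as `φ ↦ 𝓛_{t,w}φ + 4q e^{−4w}φ` is
invertible: "For `t ≤ 1`, … `L^t(g⁻¹A^t_u)` is positive definite, so `𝓛^t` is elliptic. Since the coefficient of `φ` in the
zeroth-order term is strictly negative, the linearization is furthermore invertible on the stated Hölder spaces (see [GT])".
Proof plan: `−L` has chart representation `Σ a ∂² + Σ b ∂ + c` (coefficients = jet-derivatives of the chart structure function at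
the smooth 2-jet of `w`, uniformly elliptic by `neg_principalForm_apply_self_nonneg`/`apply_self_lt_Lt_mul` and compactness,
`c = −4q e^{−4w} ≤ −c₀ < 0`); along the segment `L_s = (1−s)(Δ_g − 1) + s(−L)` the global Schauder estimate
`exists_schauder_global` and the maximum-principle bound `mul_abs_le_of_maximumPrinciple` give `‖u‖ ≤ C‖L_s u‖` uniformly;
`Δ_g − 1` is onto by STUB O5 and `exists_modelOperator_continuousLinearEquiv_of_estimate`; the method of continuity
(`bijective_of_surjective_of_forall_norm_le_lineMap`) and the open mapping theorem (`ContinuousLinearEquiv.ofBijective`) finish.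
[cite: GurskyViaclovsky2003, §2, Prop. 2] [cite: GilbargTrudinger2001, Thm. 5.2 and Thm. 6.2] -/
theorem stub_linearisedInvertible :
    ∀ (M : Type) [TopologicalSpace M] [T2Space M] [ChartedSpace (EuclideanSpace ℝ (Fin 4)) M]
      [IsManifold (𝓡 4) ∞ M] [CompactSpace M] {ι : Type} [Fintype ι]
      (𝔄 : HolderChartData ι (EuclideanSpace ℝ (Fin 4)) M)
      (g : PseudoRiemannianMetric (𝓡 4) ∞ (EuclideanSpace ℝ (Fin 4)) (TangentSpace (𝓡 4) : M → Type _))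
      [g.HasLeviCivita], g.IsRiemannian →
      ∀ (q : M → ℝ), ContMDiff (𝓡 4) 𝓘(ℝ) ∞ q → (∀ x, 0 < q x) → ∀ {α : ℝ≥0}, 0 < α → α < 1 →
      ∀ (t : ℝ), t ≤ 1 → ∀ (w : M → ℝ), ContMDiff (𝓡 4) 𝓘(ℝ) ∞ w →
      (∀ x, 0 < backgroundScalar g w x) →
      (∀ x, backgroundPathOperator g t w x = q x * Real.exp (-4 * w x)) →
      ∀ L : HolderManifoldFunction 𝔄 ℝ 2 α →L[ℝ] HolderManifoldFunction 𝔄 ℝ 0 α,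
        (∀ (φ : HolderManifoldFunction 𝔄 ℝ 2 α) (x : M),
          L φ x = linearisedBackgroundOperator g t w φ x + 4 * q x * Real.exp (-4 * w x) * φ x) →
        L.IsInvertible := by
  sorry

/-- **STUB O3 — ELLIPTIC REGULARITY: admissible `C^{2,α}_𝔄` solutions of the weighted path equation with `t ≤ 1` are
`C^∞`** (Gursky–Viaclovsky 2003, §5: "since `f ∈ C^∞(M)`, it follows from classical elliptic regularity theory that
`u_t ∈ C^∞(M)`" = Gilbarg–Trudinger Lemma 17.16, regularity half: difference quotients of the chart equation
`G_j(y, J²(w∘chart_j⁻¹)) = 0` satisfy linear equations with `C^{0,α}` coefficients, uniformly elliptic near the solution's jets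
by admissibility (`t ≤ 1`); the interior Schauder estimate on balls bounds them in `C^{2,α}`, Arzelà–Ascoli passes to the limit,
so `w ∈ C^{3,α}`; differentiate once and induct). [cite: GurskyViaclovsky2003, §5] [cite: GilbargTrudinger2001, Lemma 17.16] -/
theorem stub_regularity :
    ∀ (M : Type) [TopologicalSpace M] [T2Space M] [ChartedSpace (EuclideanSpace ℝ (Fin 4)) M]
      [IsManifold (𝓡 4) ∞ M] [CompactSpace M] {ι : Type} [Fintype ι]
      (𝔄 : HolderChartData ι (EuclideanSpace ℝ (Fin 4)) M)
      (g : PseudoRiemannianMetric (𝓡 4) ∞ (EuclideanSpace ℝ (Fin 4)) (TangentSpace (𝓡 4) : M → Type _))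
      [g.HasLeviCivita], g.IsRiemannian →
      ∀ (q : M → ℝ), ContMDiff (𝓡 4) 𝓘(ℝ) ∞ q → (∀ x, 0 < q x) → ∀ {α : ℝ≥0}, 0 < α → α < 1 →
      ∀ (t : ℝ), t ≤ 1 → ∀ (w : HolderManifoldFunction 𝔄 ℝ 2 α),
      (∀ x, 0 < backgroundScalar g w x) →
      (∀ x, backgroundPathOperator g t w x = q x * Real.exp (-4 * w x)) →
      ContMDiff (𝓡 4) 𝓘(ℝ) ∞ (w : M → ℝ) := by
  sorry

/-- **STUB O4 — ADMISSIBILITY PERSISTS: `X`-convergence ⇒ uniform convergence of `backgroundScalar`** (the step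
"`A^t_{u_t} ∈ Γ₂⁺` for `t` near `t₀`" of §5 in the tree's vocabulary `R_{h_t} > 0`: `backgroundScalar g w = R_g − 6Δ_g w −
6|dw|²_g` depends continuously, in the sup norm, on `w ∈ C^{2,α}_𝔄` — `dalembertianCLM` is bounded into `C^{0,α}_𝔄`,
`‖f x‖ ≤ card ι · ‖f‖`, and `|dw|²_g` is controlled by the chart `C¹` norms of the pieces).
[cite: GurskyViaclovsky2003, §5 (proof of Thm. 1)] -/
theorem stub_backgroundScalarTendsto :
    ∀ (M : Type) [TopologicalSpace M] [T2Space M] [ChartedSpace (EuclideanSpace ℝ (Fin 4)) M]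
      [IsManifold (𝓡 4) ∞ M] [CompactSpace M] {ι : Type} [Fintype ι]
      (𝔄 : HolderChartData ι (EuclideanSpace ℝ (Fin 4)) M)
      (g : PseudoRiemannianMetric (𝓡 4) ∞ (EuclideanSpace ℝ (Fin 4)) (TangentSpace (𝓡 4) : M → Type _))
      [g.HasLeviCivita] {α : ℝ≥0} (ψ : ℝ → HolderManifoldFunction 𝔄 ℝ 2 α)
      (W₀ : HolderManifoldFunction 𝔄 ℝ 2 α) (t₀ : ℝ), Tendsto ψ (𝓝 t₀) (𝓝 W₀) →
      TendstoUniformly (fun t x => backgroundScalar g (ψ t) x) (fun x => backgroundScalar g W₀ x) (𝓝 t₀) :=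
  -- DISCHARGED (r18): Theorems/EntropyRungChangGurskyYangStubBackgroundScalarTendsto.lean (wave 1, p165061)
  Summit.SmoothPoincare4.SmoothPoincare4.Theorems.MargerinRails.stub_backgroundScalarTendsto

/-- **STUB 6c — OPENNESS OF THE SOLVABLE SET along the weighted path (named fact
`Literature.Geometry.Riemannian.gurskyViaclovsky_pathOpen_weighted_four`, `GurskyViaclovskyOpenness.lean`, p102659;
GV 2003 Prop. 2 + §5).** NOW SORRY-FREE GLUE (reshape r17) over STUBS O1–O4 (O5 enters through O2): Hölder chart data `𝔄`
on the compact `M` (`HolderChartData.exists_of_compactSpace`), `α = 1/2`, the background solution `w₀` at `t₀`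
(`solvable_iff_exists_background`) as a member `W₀ ∈ X` (`ofContMDiff`), the zero-finding map `Φ` of STUB O1 with
`Φ(t₀, W₀) = 0`, invertibility of `∂_wΦ(t₀, W₀)` by STUB O2, the implicit function theorem
(`exists_solution_nhds_of_hasStrictFDerivAt`) giving `t ↦ ψ_t` with `Φ(t, ψ_t) = 0` and `ψ_t → W₀`, persistence of
`backgroundScalar > 0` by STUB O4 and `eventually_forall_pos_of_tendstoUniformly`, smoothness of `ψ_t` for `t ≤ 1` by STUB O3,
and `solvable_of_background`; `exists_Ioo_of_eventually_nhds` produces the interval.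
[cite: GurskyViaclovsky2003, Prop. 2 and §5] [cite: GilbargTrudinger2001, Thm. 17.6] -/
theorem stub_gvOpen : gurskyViaclovsky_pathOpen_weighted_four := by
  intro M _ _ _ _ _ _ _ g _ hg q hq hqpos t₀ ht₀ hsolv
  classical
  -- Hölder chart data on the compact manifold, exponent `α = 1/2`
  obtain ⟨s, ⟨𝔄⟩⟩ := HolderChartData.exists_of_compactSpace (EuclideanSpace ℝ (Fin 4)) M
  set α : ℝ≥0 := 1 / 2 with hαdef
  have hα0 : 0 < α := by rw [hαdef]; positivity
  have hα1 : α < 1 := by rw [hαdef]; exact NNReal.half_lt_self one_ne_zero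
  -- the smooth admissible background solution at `t₀`
  obtain ⟨w₀, hw₀, hpos₀, heq₀⟩ := (solvable_iff_exists_background g hg t₀ q).1 hsolv
  set W₀ : HolderManifoldFunction 𝔄 ℝ 2 α := HolderManifoldFunction.ofContMDiff w₀ hw₀ hα1.le with hW₀def
  have hW₀ : ((W₀ : HolderManifoldFunction 𝔄 ℝ 2 α) : M → ℝ) = w₀ :=
    HolderManifoldFunction.coe_ofContMDiff w₀ hw₀ hα1.le
  -- STUB O1: the zero-finding map and its strict derivative at `(t₀, W₀)`
  obtain ⟨Φ, hΦeq, hΦd⟩ := stub_pathMapStrictFDeriv M 𝔄 g hg q hq hα1.le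
  obtain ⟨Φ', hΦ', hΦ'eq⟩ := hΦd t₀ W₀
  -- STUB O2: its partial derivative in `w` is invertible
  have hinv : (Φ' ∘L ContinuousLinearMap.inr ℝ ℝ (HolderManifoldFunction 𝔄 ℝ 2 α)).IsInvertible := by
    refine stub_linearisedInvertible M 𝔄 g hg q hq hqpos hα0 hα1 t₀ ht₀ w₀ hw₀ hpos₀ heq₀ _ fun φ x => ?_
    rw [ContinuousLinearMap.comp_apply, ContinuousLinearMap.inr_apply, hΦ'eq φ x, hW₀]
  -- `Φ(t₀, W₀) = 0`
  have h0 : Φ (t₀, W₀) = 0 := by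
    refine HolderManifoldFunction.ext fun x => ?_
    rw [hΦeq, hW₀, heq₀ x, sub_self, HolderManifoldFunction.coe_zero, Pi.zero_apply]
  -- the implicit function theorem
  obtain ⟨ψ, hψ, hzero⟩ := exists_solution_nhds_of_hasStrictFDerivAt hΦ' hinv h0
  have heq : ∀ᶠ t in 𝓝 t₀, ∀ x, backgroundPathOperator g t (ψ t) x = q x * Real.exp (-4 * ψ t x) := by
    filter_upwards [hzero] with t ht x
    have h := congrArg (fun F : HolderManifoldFunction 𝔄 ℝ 0 α => F x) ht
    simp only [hΦeq, HolderManifoldFunction.coe_zero, Pi.zero_apply] at h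
    linarith
  -- STUB O4: admissibility persists
  have hunif : TendstoUniformly (fun t x => backgroundScalar g (ψ t) x) (backgroundScalar g w₀) (𝓝 t₀) := by
    have h := stub_backgroundScalarTendsto M 𝔄 g ψ W₀ t₀ hψ
    rwa [hW₀] at h
  have hposev : ∀ᶠ t in 𝓝 t₀, ∀ x, 0 < backgroundScalar g (ψ t) x :=
    eventually_forall_pos_of_tendstoUniformly (contMDiff_backgroundScalar g hw₀).continuous hpos₀ hunif
  -- STUB O3: the solutions are smooth for `t ≤ 1`; conclude with the dictionary
  have key : ∀ᶠ t in 𝓝 t₀, t ≤ 1 → Solvable g t q := by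
    filter_upwards [heq, hposev] with t ht hp htle
    exact solvable_of_background g hg
      (stub_regularity M 𝔄 g hg q hq hqpos hα0 hα1 t htle (ψ t) hp ht) hp ht
  obtain ⟨ε, hε, hball⟩ := exists_Ioo_of_eventually_nhds key
  exact ⟨ε, hε, fun t h1 h2 h3 => hball t h1 h2 h3⟩

end OpennessStubs

/-- **STUB 6d — CLOSEDNESS OF THE SOLVABLE SET given the `C⁰, C¹, C²` bounds (named fact
`Literature.Geometry.Riemannian.gurskyViaclovsky_pathClosed_weighted_four`, `GurskyViaclovskyClosedness.lean`, p102883;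
GV 2003 Prop. 6 / §5).** DISCHARGED (reshape r16, lead c7): the fact is PROVED IN THE TREE,
`GurskyViaclovskyPath.gurskyViaclovsky_pathClosed_weighted_four_holds`
(`Literature/Geometry/Riemannian/GurskyViaclovskyClosednessEvansKrylov.lean`): uniform ellipticity from the `C²` bound and the
admissible cone, the interior Evans–Krylov `C^{2,α}` estimate for the concave `σ₂^{1/2}` chart equation (Gilbarg–Trudinger
Thm. 17.14, formalised from the weak Harnack inequality Thm. 9.22, the Motzkin–Wasow Lemma 17.13 and Lemma 8.23:
`Literature.Analysis.PDE.EvansKrylov.evansKrylov_interior_holder`, transported to charts in `chart_holderOnWith_two`), the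
Schauder bootstrap (Lemma 17.16, `chart_uniform_bounds_of_holderOnWith_two`) and the Arzelà–Ascoli extraction with the
limit argument (`pathClosed_of_chartHigherBounds`). Theorems-side copy: `Theorems/EntropyRungChangGurskyYangStubGvClosed.lean`.
[cite: GurskyViaclovsky2003, Prop. 6 and §5] [cite: GilbargTrudinger2001, Thm. 17.14, Lemma 17.16] -/
theorem stub_gvClosed : gurskyViaclovsky_pathClosed_weighted_four :=
  -- DISCHARGED (reshape r16): PROVED IN THE TREE, Literature/Geometry/Riemannian/GurskyViaclovskyClosednessEvansKrylov.lean
  GurskyViaclovskyPath.gurskyViaclovsky_pathClosed_weighted_four_holds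

/-- **STUB 6 — CGY 2003 THEOREM 1.4 (`α = 1`) IN THE CONNECTED `scal > 0` SHAPE (= Disproof §7
`Thm14LeafPsc` = card gv-continuity-path's `thm14_gurskyViaclovsky` = card gv-weyl-shifted-path's
`WeylShiftedGV`, VERBATIM).** On a closed CONNECTED smooth 4-manifold, a `C^∞` Riemannian `g₀` with
`R > 0` and `¼∫|W|² < ∫σ₂(A)` is conformal to a `C^∞` Riemannian `g` with `R > 0` and
`¼|W|² < σ₂(A)` POINTWISE. TRUE in print (CGY 2003 Thm. 1.4 with Aubin `scal > 0 ⇒ Y > 0` and p. 108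
"in particular `R > 0`"; the tree proves `Thm14LeafConnected → Thm14LeafPsc`,
`thm14LeafPsc_of_connected`); the unconnected `hThm14` of the tree's reduction is PAPER-FALSE
(`S⁴ ⊔ S³×S¹`, Disproof §7 `thm14Leaf_false`) and is NOT used here. This is the σ₂ leaf — the line's
Achilles heel, untouched by the lever: proof = [CGY1] (Annals 155 (2002)) δ-regularised fourth-order
equation + CGY 2003 §3 degree theory, or the Gursky–Viaclovsky positive-exponent continuity path with
the Weyl weight `ψ_W = ¼|W_g|²_g` carried as an `x`-term (cards gv-*, triage finding B: every GV estimate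
survives the weight). NOW SORRY-FREE GLUE (reshape r9): `stub_thm14Psc_of_theorem14` (p83080) after
`changGurskyYang_theorem14_four_of_gvPathFacts` (p108727) applied to STUBS 6a–6d; the registered statement is UNCHANGED. [cite: ChangGurskyYang2003, Thm. 1.4 (p. 112) and p. 108]
[cite: GurskyViaclovsky2003, Props. 4–6] -/
theorem stub_thm14Psc :
    ∀ (M : Type) [TopologicalSpace M] [T2Space M] [SecondCountableTopology M]
      [ChartedSpace (EuclideanSpace ℝ (Fin 4)) M] [IsManifold (𝓡 4) ∞ M] [CompactSpace M]
      [ConnectedSpace M] [MeasurableSpace M] [BorelSpace M]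
      (g₀ : PseudoRiemannianMetric (𝓡 4) ∞ (EuclideanSpace ℝ (Fin 4)) (TangentSpace (𝓡 4) : M → Type _))
      [g₀.HasLeviCivita] (hg₀ : g₀.IsRiemannian),
      (∀ x, 0 < g₀.scalarCurvature x) →
      1 / 4 * g₀.weylEnergy.toReal < g₀.sigma2WeylSchoutenIntegral →
      ∃ (g : PseudoRiemannianMetric (𝓡 4) ∞ (EuclideanSpace ℝ (Fin 4)) (TangentSpace (𝓡 4) : M → Type _))
        (_ : g.HasLeviCivita) (hg : g.IsRiemannian),
        IsConformalTo (g.toContMDiffRiemannianMetric hg) (g₀.toContMDiffRiemannianMetric hg₀) ∧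
        (∀ x, 0 < g.scalarCurvature x) ∧ ∀ x, 1 / 4 * g.weylNormSq x < g.sigma2WeylSchouten x :=
  Summit.SmoothPoincare4.SmoothPoincare4.Theorems.MargerinRails.stub_thm14Psc_of_theorem14
    (Summit.SmoothPoincare4.SmoothPoincare4.Theorems.GvContinuityPath.changGurskyYang_theorem14_four_of_gvPathFacts
      stub_gvGradient stub_gvHessian stub_gvOpen stub_gvClosed)

/-! ## The compositions (kernel-checked, no `sorry`) -/

/-- **MARGERIN'S LEAF FROM STUBS 1–4** (= `hMargerin` of the tree's reduction, verbatim, incl.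
`[ConnectedSpace M]` and the disjunction with `ℝP⁴` — honouring Disproof §3b): on a closed connected
4-manifold, `R > 0` and `WP < 1/6` pointwise give `M ≅ S⁴` or `M` a standard `ℝP⁴`. STUB 2 fits the
initial blocks into `Z = pinchingSet m c K (σ/2)` with `σ = σ(c)` from STUB 1; STUB 3 (with `τ = σ/2 < σ`)
keeps every Ricci flow from `g` inside `Z`; STUB 4 produces a metric of constant sectional curvature
`k > 0`; Killing–Hopf (`killingHopf_quotient_four`, PROVED) and "the only free orthogonal quotient of
`S⁴` is `ℝP⁴`" (`nonempty_diffeomorph_or_isRealProjectiveSpace_of_orthogonal_quotient`, PROVED) finish.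
[cite: Margerin1998, Thm. 1 (p. 21)] [cite: Hamilton1986, §5, 5.2 and p. 154] [cite: Lee2018, Thm. 12.4, Cor. 12.5] -/
theorem margerin_of_stubs
    (h₁ : ∀ c : ℝ, 0 ≤ c → c < 1 / 6 → ∃ σ : ℝ, 0 < σ ∧ σ ≤ 1 ∧
      ∀ p ∈ margerinCone c, margerinP2 p ≤ -(σ * (devNormSq p * scal (field p))))
    (h₂ : ∀ (M : Type) [TopologicalSpace M] [T2Space M] [SecondCountableTopology M]
      [ChartedSpace (EuclideanSpace ℝ (Fin 4)) M] [IsManifold (𝓡 4) ∞ M] [CompactSpace M]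
      (g : PseudoRiemannianMetric (𝓡 4) ∞ (EuclideanSpace ℝ (Fin 4)) (TangentSpace (𝓡 4) : M → Type _))
      [g.HasLeviCivita], g.IsRiemannian → (∀ x, 0 < g.scalarCurvature x) →
      (∀ x, g.weakPinching x < 1 / 6) →
      ∃ m c : ℝ, 0 < m ∧ 0 < c ∧ c < 1 / 6 ∧ ∀ τ : ℝ, 0 ≤ τ → τ ≤ 1 → ∃ K : ℝ, 0 < K ∧
        ∀ (cov : CovariantDerivative (𝓡 4) (EuclideanSpace ℝ (Fin 4)) (TangentSpace (𝓡 4) : M → Type _)),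
          g.IsLeviCivita cov →
          ∀ (x : M) (e : Fin 4 → TangentSpace (𝓡 4) x), g.IsOrthonormalFrame x e →
            (g.blockA cov x e, g.blockB cov x e, g.blockC cov x e) ∈ pinchingSet m c K τ)
    (h₃ : ∀ (m c K σ τ : ℝ), 0 < m → 0 < c → c < 1 / 6 → 0 < K → 0 < τ → τ < σ → σ ≤ 1 →
      (∀ p ∈ margerinCone c, margerinP2 p ≤ -(σ * (devNormSq p * scal (field p)))) →
      ∀ (M : Type) [TopologicalSpace M] [T2Space M] [SecondCountableTopology M] [CompactSpace M]
        [ChartedSpace (EuclideanSpace ℝ (Fin 4)) M] [IsManifold (𝓡 4) ∞ M] (T : ℝ)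
        (g : ℝ → PseudoRiemannianMetric (𝓡 4) ∞ (EuclideanSpace ℝ (Fin 4))
          (TangentSpace (𝓡 4) : M → Type _))
        (cov : ℝ → CovariantDerivative (𝓡 4) (EuclideanSpace ℝ (Fin 4))
          (TangentSpace (𝓡 4) : M → Type _)),
        IsRicciFlow g cov (Ico 0 T) → (∀ t ∈ Ico 0 T, (g t).IsRiemannian) →
        (∀ (x : M) (e : Fin 4 → TangentSpace (𝓡 4) x), (g 0).IsOrthonormalFrame x e →
          ((g 0).blockA (cov 0) x e, (g 0).blockB (cov 0) x e, (g 0).blockC (cov 0) x e) ∈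
            pinchingSet m c K τ) →
        ∀ t ∈ Ico 0 T, ∀ (x : M) (e : Fin 4 → TangentSpace (𝓡 4) x),
          (g t).IsOrthonormalFrame x e →
            ((g t).blockA (cov t) x e, (g t).blockB (cov t) x e, (g t).blockC (cov t) x e) ∈
              pinchingSet m c K τ)
    (h₄ : ∀ (M : Type) [TopologicalSpace M] [T2Space M] [SecondCountableTopology M]
      [ChartedSpace (EuclideanSpace ℝ (Fin 4)) M] [IsManifold (𝓡 4) ∞ M] [CompactSpace M]
      [ConnectedSpace M]
      (g₀ : PseudoRiemannianMetric (𝓡 4) ∞ (EuclideanSpace ℝ (Fin 4)) (TangentSpace (𝓡 4) : M → Type _))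
      (m c K τ : ℝ), g₀.IsRiemannian → 0 < m → 0 < c → c < 1 / 6 → 0 < K → 0 < τ → τ ≤ 1 →
      (∀ (cov : CovariantDerivative (𝓡 4) (EuclideanSpace ℝ (Fin 4)) (TangentSpace (𝓡 4) : M → Type _)),
        g₀.IsLeviCivita cov →
        ∀ (x : M) (e : Fin 4 → TangentSpace (𝓡 4) x), g₀.IsOrthonormalFrame x e →
          (g₀.blockA cov x e, g₀.blockB cov x e, g₀.blockC cov x e) ∈ pinchingSet m c K τ) →
      (∀ (T : ℝ)
        (g : ℝ → PseudoRiemannianMetric (𝓡 4) ∞ (EuclideanSpace ℝ (Fin 4))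
          (TangentSpace (𝓡 4) : M → Type _))
        (cov : ℝ → CovariantDerivative (𝓡 4) (EuclideanSpace ℝ (Fin 4))
          (TangentSpace (𝓡 4) : M → Type _)),
        IsRicciFlow g cov (Ico 0 T) → (∀ t ∈ Ico 0 T, (g t).IsRiemannian) → g 0 = g₀ →
        ∀ t ∈ Ico 0 T, ∀ (x : M) (e : Fin 4 → TangentSpace (𝓡 4) x),
          (g t).IsOrthonormalFrame x e →
            ((g t).blockA (cov t) x e, (g t).blockB (cov t) x e, (g t).blockC (cov t) x e) ∈
              pinchingSet m c K τ) →
      ∃ (k : ℝ) (g' : PseudoRiemannianMetric (𝓡 4) ∞ (EuclideanSpace ℝ (Fin 4))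
          (TangentSpace (𝓡 4) : M → Type _)),
        0 < k ∧ g'.IsRiemannian ∧ g'.HasConstantSectionalCurvature k)
    (M : Type) [TopologicalSpace M] [T2Space M] [SecondCountableTopology M]
    [ChartedSpace (EuclideanSpace ℝ (Fin 4)) M] [IsManifold (𝓡 4) ∞ M] [CompactSpace M]
    [ConnectedSpace M]
    (g : PseudoRiemannianMetric (𝓡 4) ∞ (EuclideanSpace ℝ (Fin 4)) (TangentSpace (𝓡 4) : M → Type _))
    [g.HasLeviCivita] (hg : g.IsRiemannian) (hR : ∀ x, 0 < g.scalarCurvature x)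
    (hWP : ∀ x, g.weakPinching x < 1 / 6) :
    Nonempty (M ≃ₘ⟮𝓡 4, 𝓡 4⟯ 𝕊⁴) ∨ IsRealProjectiveSpace 4 M := by
  -- STUB 2: initial fit `m, c`, and for each `τ` a `K`
  obtain ⟨m, c, hm, hc0, hc, hfit⟩ := h₂ M g hg hR hWP
  -- STUB 1: the margin `σ = σ(c)`; the line runs with `τ = σ/2 < σ`
  obtain ⟨σ, hσ0, hσ1, hpoly⟩ := h₁ c hc0.le hc
  have hτ0 : 0 < σ / 2 := by positivity
  have hτσ : σ / 2 < σ := by linarith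
  have hτ1 : σ / 2 ≤ 1 := by linarith
  obtain ⟨K, hK, hfitK⟩ := hfit (σ / 2) hτ0.le hτ1
  -- STUB 3: every Ricci flow of Riemannian metrics starting at `g` stays in `Z = pinchingSet m c K (σ/2)`
  have hpres : ∀ (T : ℝ)
      (gt : ℝ → PseudoRiemannianMetric (𝓡 4) ∞ (EuclideanSpace ℝ (Fin 4))
        (TangentSpace (𝓡 4) : M → Type _))
      (cov : ℝ → CovariantDerivative (𝓡 4) (EuclideanSpace ℝ (Fin 4))
        (TangentSpace (𝓡 4) : M → Type _)),
      IsRicciFlow gt cov (Ico 0 T) → (∀ t ∈ Ico 0 T, (gt t).IsRiemannian) → gt 0 = g →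
      ∀ t ∈ Ico 0 T, ∀ (x : M) (e : Fin 4 → TangentSpace (𝓡 4) x),
        (gt t).IsOrthonormalFrame x e →
          ((gt t).blockA (cov t) x e, (gt t).blockB (cov t) x e, (gt t).blockC (cov t) x e) ∈
            pinchingSet m c K (σ / 2) := by
    intro T gt cov hflow hRiem h0 t ht x e he
    have hT : (0 : ℝ) ∈ Ico 0 T := ⟨le_rfl, lt_of_le_of_lt ht.1 ht.2⟩
    have hLC : (gt 0).IsLeviCivita (cov 0) := hflow.isLeviCivita 0 hT
    refine h₃ m c K σ (σ / 2) hm hc0 hc hK hτ0 hτσ hσ1 hpoly M T gt cov hflow hRiem ?_ t ht x e he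
    intro y f hf
    subst h0
    exact hfitK (cov 0) hLC y f hf
  -- STUB 4: a metric of constant sectional curvature `k > 0` on `M`
  obtain ⟨k, g', hk, hg', hconst⟩ :=
    h₄ M g m c K (σ / 2) hg hm hc0 hc hK hτ0 hτ1 hfitK hpres
  -- Killing–Hopf (PROVED) and the classification of free orthogonal quotients of `S⁴` (PROVED)
  obtain ⟨Γ, q, hfree, hq, hsurj, hfib⟩ := killingHopf_quotient_four M k g' hk hg' hconst
  exact nonempty_diffeomorph_or_isRealProjectiveSpace_of_orthogonal_quotient ⟨2, rfl⟩ hfree hq hsurj hfib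

/-- **THE SKELETON THEOREM — the crux `EntropyRung.ChangGurskyYang` BY NAME, its proof calling the six
registered stubs** (CGY 2003 §2, p. 121, line by line; the glue itself is `ChangGurskyYang_of_hypotheses`
below, kernel-checked WITHOUT `sorry`; this theorem inherits the stubs' `sorry`s by design and closes the
crux the moment they land): `(0.3) ⇒ (1.2)` by Chern–Gauss–Bonnet (`stub_chernGaussBonnetFour`) and
`χ(M) ≥ 2` (PROVED); CGY Thm. 1.4, connected psc shape (`stub_thm14Psc`) ⇒ conformal `g'` with `R > 0`,
`¼|W|² < σ₂(A)` pointwise ⇒ `WP < 1/6` (PROVED rearrangement); Margerin's leaf from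
`stub_margerinPolynomial`, `stub_initialFit`, `stub_pinchingPreserved`, `stub_pinchedFlowConvergence`
(`margerin_of_stubs`) ⇒ `S⁴ ∨ ℝP⁴`; `π₁ = 1` discards `ℝP⁴` (PROVED).
[cite: ChangGurskyYang2003, §2, p. 121] [cite: Margerin1998, Thm. 1] -/
theorem ChangGurskyYang_of : ChangGurskyYang := by
  rintro M _ _ _ _ _ _ _ ⟨g, _, hgR, hscal, hW⟩
  letI : MeasurableSpace M := borel M
  haveI : BorelSpace M := ⟨rfl⟩
  have hE : finrank ℝ (EuclideanSpace ℝ (Fin 4)) = 4 := finrank_euclideanSpace_fin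
  -- (0.3) ⇒ (1.2): Chern–Gauss–Bonnet (STUB 5) and `χ(M) ≥ 2` (PROVED)
  have h12 : 1 / 4 * g.weylEnergy.toReal < g.sigma2WeylSchoutenIntegral :=
    quarter_weylEnergy_lt_of_chernGaussBonnet g hgR (stub_chernGaussBonnetFour M g hgR) hW
  -- Thm. 1.4, connected psc shape (STUB 6)
  obtain ⟨g', _, hg'R, -, hscal', hpt⟩ := stub_thm14Psc M g hgR hscal h12
  have hpos' : ∀ (x : M) (v : TangentSpace (𝓡 4) x), v ≠ 0 → 0 < g'.val x v v :=
    fun x v hv ↦ hg'R x v hv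
  -- "rearranging terms": `WP < 1/6` pointwise (PROVED)
  have hWP : ∀ x, g'.weakPinching x < 1 / 6 := fun x ↦
    g'.weakPinching_lt_of_sigma2WeylSchouten_gt (WithTop.coe_le_coe.mpr le_top) hE (hpos' x) (hpt x)
  -- Margerin's leaf from STUBS 1–4 (+ Killing–Hopf, PROVED): `S⁴ ∨ ℝP⁴`; `π₁ = 1` excludes `ℝP⁴`
  rcases margerin_of_stubs stub_margerinPolynomial stub_initialFit stub_pinchingPreserved
      stub_pinchedFlowConvergence M g' hg'R hscal' hWP with h | h
  · exact h
  · exact absurd ‹SimplyConnectedSpace M› (h.not_simplyConnectedSpace (by norm_num))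

/-- **The same skeleton theorem for the item's OTHER route decl `WeylBudget.ChangGurskyYang`** (rank 9 of
route WeylBudget; the two route decls are the same proposition, `Iff.rfl` — Disproof §1
`weylBudget_crux_iff`), so that `ledger skeleton check` finds the crux by name under either route.
[cite: ChangGurskyYang2003, Thm. A] -/
theorem ChangGurskyYang_of_weylBudget :
    Summit.SmoothPoincare4.SmoothPoincare4.Theses.WeylBudget.ChangGurskyYang :=
  ChangGurskyYang_of

/-- **THE COMPOSITION IN HYPOTHESIS FORM (sorry-free kernel certificate of the glue; axioms
`propext`, `Classical.choice`, `Quot.sound`)** — the crux `EntropyRung.ChangGurskyYang` from the six stub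
STATEMENTS as hypotheses (CGY 2003 §2, p. 121, line by line): `(0.3) ⇒ (1.2)` by Chern–Gauss–Bonnet
(STUB 5) and `χ(M) ≥ 2` for closed simply connected `M` (`quarter_weylEnergy_lt_of_chernGaussBonnet`, the
Euler-characteristic half PROVED in the tree); Thm. 1.4 in the connected psc shape (STUB 6) gives a
conformal metric with `R > 0` and `¼|W|² < σ₂(A)` pointwise; "rearranging terms"
(`weakPinching_lt_of_sigma2WeylSchouten_gt`, PROVED) gives `WP < 1/6`; Margerin's leaf from STUBS 1–4
(`margerin_of_stubs`) gives `S⁴ ∨ ℝP⁴`; `π₁ = 1` discards `ℝP⁴`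
(`IsRealProjectiveSpace.not_simplyConnectedSpace`, PROVED). `ChangGurskyYang_of` above is this theorem
applied to the registered stubs. [cite: ChangGurskyYang2003, §2, p. 121] [cite: Margerin1998, Thm. 1] -/
theorem ChangGurskyYang_of_hypotheses :
    (∀ c : ℝ, 0 ≤ c → c < 1 / 6 → ∃ σ : ℝ, 0 < σ ∧ σ ≤ 1 ∧
      ∀ p ∈ margerinCone c, margerinP2 p ≤ -(σ * (devNormSq p * scal (field p)))) →
    (∀ (M : Type) [TopologicalSpace M] [T2Space M] [SecondCountableTopology M]
      [ChartedSpace (EuclideanSpace ℝ (Fin 4)) M] [IsManifold (𝓡 4) ∞ M] [CompactSpace M]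
      (g : PseudoRiemannianMetric (𝓡 4) ∞ (EuclideanSpace ℝ (Fin 4)) (TangentSpace (𝓡 4) : M → Type _))
      [g.HasLeviCivita], g.IsRiemannian → (∀ x, 0 < g.scalarCurvature x) →
      (∀ x, g.weakPinching x < 1 / 6) →
      ∃ m c : ℝ, 0 < m ∧ 0 < c ∧ c < 1 / 6 ∧ ∀ τ : ℝ, 0 ≤ τ → τ ≤ 1 → ∃ K : ℝ, 0 < K ∧
        ∀ (cov : CovariantDerivative (𝓡 4) (EuclideanSpace ℝ (Fin 4)) (TangentSpace (𝓡 4) : M → Type _)),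
          g.IsLeviCivita cov →
          ∀ (x : M) (e : Fin 4 → TangentSpace (𝓡 4) x), g.IsOrthonormalFrame x e →
            (g.blockA cov x e, g.blockB cov x e, g.blockC cov x e) ∈ pinchingSet m c K τ) →
    (∀ (m c K σ τ : ℝ), 0 < m → 0 < c → c < 1 / 6 → 0 < K → 0 < τ → τ < σ → σ ≤ 1 →
      (∀ p ∈ margerinCone c, margerinP2 p ≤ -(σ * (devNormSq p * scal (field p)))) →
      ∀ (M : Type) [TopologicalSpace M] [T2Space M] [SecondCountableTopology M] [CompactSpace M]
        [ChartedSpace (EuclideanSpace ℝ (Fin 4)) M] [IsManifold (𝓡 4) ∞ M] (T : ℝ)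
        (g : ℝ → PseudoRiemannianMetric (𝓡 4) ∞ (EuclideanSpace ℝ (Fin 4))
          (TangentSpace (𝓡 4) : M → Type _))
        (cov : ℝ → CovariantDerivative (𝓡 4) (EuclideanSpace ℝ (Fin 4))
          (TangentSpace (𝓡 4) : M → Type _)),
        IsRicciFlow g cov (Ico 0 T) → (∀ t ∈ Ico 0 T, (g t).IsRiemannian) →
        (∀ (x : M) (e : Fin 4 → TangentSpace (𝓡 4) x), (g 0).IsOrthonormalFrame x e →
          ((g 0).blockA (cov 0) x e, (g 0).blockB (cov 0) x e, (g 0).blockC (cov 0) x e) ∈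
            pinchingSet m c K τ) →
        ∀ t ∈ Ico 0 T, ∀ (x : M) (e : Fin 4 → TangentSpace (𝓡 4) x),
          (g t).IsOrthonormalFrame x e →
            ((g t).blockA (cov t) x e, (g t).blockB (cov t) x e, (g t).blockC (cov t) x e) ∈
              pinchingSet m c K τ) →
    (∀ (M : Type) [TopologicalSpace M] [T2Space M] [SecondCountableTopology M]
      [ChartedSpace (EuclideanSpace ℝ (Fin 4)) M] [IsManifold (𝓡 4) ∞ M] [CompactSpace M]
      [ConnectedSpace M]
      (g₀ : PseudoRiemannianMetric (𝓡 4) ∞ (EuclideanSpace ℝ (Fin 4)) (TangentSpace (𝓡 4) : M → Type _))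
      (m c K τ : ℝ), g₀.IsRiemannian → 0 < m → 0 < c → c < 1 / 6 → 0 < K → 0 < τ → τ ≤ 1 →
      (∀ (cov : CovariantDerivative (𝓡 4) (EuclideanSpace ℝ (Fin 4)) (TangentSpace (𝓡 4) : M → Type _)),
        g₀.IsLeviCivita cov →
        ∀ (x : M) (e : Fin 4 → TangentSpace (𝓡 4) x), g₀.IsOrthonormalFrame x e →
          (g₀.blockA cov x e, g₀.blockB cov x e, g₀.blockC cov x e) ∈ pinchingSet m c K τ) →
      (∀ (T : ℝ)
        (g : ℝ → PseudoRiemannianMetric (𝓡 4) ∞ (EuclideanSpace ℝ (Fin 4))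
          (TangentSpace (𝓡 4) : M → Type _))
        (cov : ℝ → CovariantDerivative (𝓡 4) (EuclideanSpace ℝ (Fin 4))
          (TangentSpace (𝓡 4) : M → Type _)),
        IsRicciFlow g cov (Ico 0 T) → (∀ t ∈ Ico 0 T, (g t).IsRiemannian) → g 0 = g₀ →
        ∀ t ∈ Ico 0 T, ∀ (x : M) (e : Fin 4 → TangentSpace (𝓡 4) x),
          (g t).IsOrthonormalFrame x e →
            ((g t).blockA (cov t) x e, (g t).blockB (cov t) x e, (g t).blockC (cov t) x e) ∈
              pinchingSet m c K τ) →
      ∃ (k : ℝ) (g' : PseudoRiemannianMetric (𝓡 4) ∞ (EuclideanSpace ℝ (Fin 4))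
          (TangentSpace (𝓡 4) : M → Type _)),
        0 < k ∧ g'.IsRiemannian ∧ g'.HasConstantSectionalCurvature k) →
    chernGaussBonnet_four →
    (∀ (M : Type) [TopologicalSpace M] [T2Space M] [SecondCountableTopology M]
      [ChartedSpace (EuclideanSpace ℝ (Fin 4)) M] [IsManifold (𝓡 4) ∞ M] [CompactSpace M]
      [ConnectedSpace M] [MeasurableSpace M] [BorelSpace M]
      (g₀ : PseudoRiemannianMetric (𝓡 4) ∞ (EuclideanSpace ℝ (Fin 4)) (TangentSpace (𝓡 4) : M → Type _))
      [g₀.HasLeviCivita] (hg₀ : g₀.IsRiemannian),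
      (∀ x, 0 < g₀.scalarCurvature x) →
      1 / 4 * g₀.weylEnergy.toReal < g₀.sigma2WeylSchoutenIntegral →
      ∃ (g : PseudoRiemannianMetric (𝓡 4) ∞ (EuclideanSpace ℝ (Fin 4)) (TangentSpace (𝓡 4) : M → Type _))
        (_ : g.HasLeviCivita) (hg : g.IsRiemannian),
        IsConformalTo (g.toContMDiffRiemannianMetric hg) (g₀.toContMDiffRiemannianMetric hg₀) ∧
        (∀ x, 0 < g.scalarCurvature x) ∧ ∀ x, 1 / 4 * g.weylNormSq x < g.sigma2WeylSchouten x) →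
    ChangGurskyYang := by
  intro h₁ h₂ h₃ h₄ hCGB h14
  rintro M _ _ _ _ _ _ _ ⟨g, _, hgR, hscal, hW⟩
  letI : MeasurableSpace M := borel M
  haveI : BorelSpace M := ⟨rfl⟩
  have hE : finrank ℝ (EuclideanSpace ℝ (Fin 4)) = 4 := finrank_euclideanSpace_fin
  -- (0.3) ⇒ (1.2): Chern–Gauss–Bonnet (STUB 5) and `χ(M) ≥ 2` (PROVED) give `¼∫|W|² < ∫σ₂(A)`
  have h12 : 1 / 4 * g.weylEnergy.toReal < g.sigma2WeylSchoutenIntegral :=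
    quarter_weylEnergy_lt_of_chernGaussBonnet g hgR (hCGB M g hgR) hW
  -- Thm. 1.4 (connected, psc shape; STUB 6): a conformal `g'` with `R > 0` and `¼|W|² < σ₂(A)` pointwise
  obtain ⟨g', _, hg'R, -, hscal', hpt⟩ := h14 M g hgR hscal h12
  have hpos' : ∀ (x : M) (v : TangentSpace (𝓡 4) x), v ≠ 0 → 0 < g'.val x v v :=
    fun x v hv ↦ hg'R x v hv
  -- "rearranging terms": `WP < 1/6` pointwise
  have hWP : ∀ x, g'.weakPinching x < 1 / 6 := fun x ↦
    g'.weakPinching_lt_of_sigma2WeylSchouten_gt (WithTop.coe_le_coe.mpr le_top) hE (hpos' x) (hpt x)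
  -- Margerin's leaf from STUBS 1–4: `S⁴` or `ℝP⁴`; `π₁ = 1` excludes `ℝP⁴`
  rcases margerin_of_stubs h₁ h₂ h₃ h₄ M g' hg'R hscal' hWP with h | h
  · exact h
  · exact absurd ‹SimplyConnectedSpace M› (h.not_simplyConnectedSpace (by norm_num))


/-- **Signature certificate**: the registered stubs are EXACTLY the hypotheses of
`ChangGurskyYang_of_hypotheses` (this term typechecks iff every stub statement matches the corresponding
hypothesis symbol for symbol). [folklore] -/
theorem changGurskyYang_of_stubs : ChangGurskyYang :=
  ChangGurskyYang_of_hypotheses stub_margerinPolynomial stub_initialFit stub_pinchingPreserved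
    stub_pinchedFlowConvergence stub_chernGaussBonnetFour stub_thm14Psc

end Summit.SmoothPoincare4.SmoothPoincare4.Cruxes.ChangGurskyYang.MargerinConeHamiltonRails

end
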